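import Mathlib
import Literature.NumberTheory.ModularForms.LevelTwoThetaForms
import Literature.NumberTheory.ModularForms.LevelTwoReduction
import Literature.NumberTheory.Automorphic.HeckeTriangleEichlerGreen
import Literature.Probability.RandomPlanarGeometry.KlebanZagierTheorem2
import HarnessLib

/-!
# The level-two weight-4 Green function at `(i−1)/2` as an Eichler integral of `Δ₂/𝓔²`

[topic NumberTheory/Automorphic]

Support file for `Literature.NumberTheory.Automorphic.Zhou2015_legendreP_sq_integral`
(Zhou 2015, Remark 9, level `2`): the automorphic Green function `G₂^{Γ₀(2)}(z, c₂)`,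
`c₂ = (i − 1)/2 = cmLevelTwo` (the elliptic point of order `2` of `Γ₀(2)`), is constructed from the
Eichler integral of the weight-4 form `f₂ = Δ₂/𝓔²` of `LevelTwoThetaForms.lean` (double pole on the
orbit of `c₂`) through the generic Hecke-triangle construction of `HeckeTriangleEichlerGreen.lean`
in the coordinate `v = √2 z` (in which `Γ₀(2)⁺ = ⟨T, W₂⟩` becomes `⟨T^{√2}, S⟩`), extended to `ℍ`
through the fundamental domain `𝒟₂ = {|Re| ≤ ½, |z|² ≥ ½}` of `LevelTwoReduction.lean`, and matched
with the tree's `higherGreen 2 2 1 · cmLevelTwo` by uniqueness of resolvent Green functions.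

## Main results (sorry-free)

* `dataTwo : HeckeFormData` (`g = f₂(·/√2)`, `a = √2/2`, `per = √2`);
* `FTwo`, `isResolventGreenLike_FTwo : IsResolventGreenLike 2 2 cmLevelTwo FTwo` (given
  `Im M₁(i) = 0`);
* the local expansion of `f₂` at `c₂` with leading coefficient `a₂ = Δ₂(c₂)/𝓔'(c₂)² = 1/(64π²)`
  (`λ(c₂) = 2`, `λ' = πiλθ₄⁴`), `FTwo_log_bound`, `card_stabilizer_cmLevelTwo = 4`, and
  **`higherGreen 2 2 1 z cmLevelTwo = −128π² · FTwo z`** (`higherGreen_eq_CTwo_mul_FTwo`);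
* **Remark 9 (iii)a from the axis inputs** (`higherGreen_cmLevelTwo_of_axis`): if `f₂(it)` is real
  and `∫_{t>1/√2} f₂(it) dt = (256π)⁻¹ L`, then `higherGreen 2 2 1 cmLevelTwo cmLevelTwo' = −(2π/√2)·L`.

## References

* Y. Zhou, *Kontsevich–Zagier integrals for automorphic Green's functions. I*, Ramanujan J. 38
  (2015), Remark 9, eq. (G2_Hecke2_spec_val). [cite: Zhou2015, Remark 9]
* B. Gross, D. Zagier, Invent. Math. 84 (1986), §II.2. [cite: GrossZagier1986, §II.2]
-/

noncomputable section

open UpperHalfPlane hiding I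
open Complex Filter Topology ModularForm Real Set MeasureTheory Laplacian CongruenceSubgroup
open scoped MatrixGroups Manifold Topology

namespace Literature.NumberTheory.Automorphic.GreenTwo

open Literature.NumberTheory.ModularForms
open Literature.NumberTheory.Automorphic.HeckeFormData

/-! ## 1. The scaled form `g₂(v) = f₂(v/√2)` and the datum `dataTwo` -/

/-- `√2`. [folklore] -/
def s2 : ℝ := Real.sqrt 2

/-- `√2 > 0`. [folklore] -/
theorem s2_pos : 0 < s2 := by rw [s2]; positivity

/-- `√2² = 2`. [folklore] -/
theorem s2_sq : s2 ^ 2 = 2 := by rw [s2, Real.sq_sqrt (by norm_num)]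

/-- `√2 · √2 = 2`. [folklore] -/
theorem s2_mul_s2 : s2 * s2 = 2 := by rw [← sq, s2_sq]

/-- `1 < √2 < 2`. [folklore] -/
theorem one_lt_s2 : 1 < s2 := by
  rw [s2]
  have : Real.sqrt 1 < Real.sqrt 2 := Real.sqrt_lt_sqrt (by norm_num) (by norm_num)
  rwa [Real.sqrt_one] at this

/-- `√2 < 2`. [folklore] -/
theorem s2_lt_two : s2 < 2 := by nlinarith [s2_mul_s2, s2_pos, one_lt_s2]

/-- `(√2 : ℂ) ≠ 0`. [folklore] -/
theorem s2C_ne_zero : (s2 : ℂ) ≠ 0 := by exact_mod_cast s2_pos.ne'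

/-- `v ↦ v/√2` on `ℍ`. [folklore] -/
def scaleDown (τ : ℍ) : ℍ := ⟨(τ : ℂ) / s2, by
  rw [Complex.div_ofReal_im]; exact div_pos τ.im_pos s2_pos⟩

/-- `z ↦ √2 z` on `ℍ`. [folklore] -/
def scaleUp (τ : ℍ) : ℍ := ⟨(s2 : ℂ) * τ, by
  rw [Complex.mul_im, Complex.ofReal_re, Complex.ofReal_im]; simp; exact mul_pos s2_pos τ.im_pos⟩

/-- Coordinates. [folklore] -/
@[simp] theorem coe_scaleDown (τ : ℍ) : ((scaleDown τ : ℍ) : ℂ) = (τ : ℂ) / s2 := rfl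

/-- Coordinates. [folklore] -/
@[simp] theorem coe_scaleUp (τ : ℍ) : ((scaleUp τ : ℍ) : ℂ) = (s2 : ℂ) * τ := rfl

/-- Heights. [folklore] -/
theorem scaleDown_im (τ : ℍ) : (scaleDown τ).im = τ.im / s2 := by
  rw [← UpperHalfPlane.coe_im, coe_scaleDown, Complex.div_ofReal_im, UpperHalfPlane.coe_im]

/-- Heights. [folklore] -/
theorem scaleUp_im (τ : ℍ) : (scaleUp τ).im = s2 * τ.im := by
  rw [← UpperHalfPlane.coe_im, coe_scaleUp, Complex.mul_im]; simp

/-- `scaleDown ∘ scaleUp = id`. [folklore] -/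
theorem scaleDown_scaleUp (τ : ℍ) : scaleDown (scaleUp τ) = τ := by
  apply UpperHalfPlane.ext; simp [mul_div_cancel_left₀ _ s2C_ne_zero]

/-- `scaleDown` through `ofComplex`. [folklore] -/
theorem scaleDown_ofComplex {w : ℂ} (hw : 0 < w.im) : scaleDown (ofComplex w) = ofComplex (w / s2) := by
  have hw' : 0 < (w / s2).im := by rw [Complex.div_ofReal_im]; exact div_pos hw s2_pos
  apply UpperHalfPlane.ext
  rw [coe_scaleDown, ofComplex_apply_of_im_pos hw, ofComplex_apply_of_im_pos hw']

/-- `scaleDown (S • τ) = W₂ (scaleDown τ)`: the Fricke involution becomes `S`. [folklore] -/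
theorem scaleDown_S_smul (τ : ℍ) : scaleDown (ModularGroup.S • τ) = frickeTwo (scaleDown τ) := by
  apply UpperHalfPlane.ext
  rw [coe_scaleDown, coe_frickeTwo, coe_scaleDown, UpperHalfPlane.modular_S_smul, coe_mk]
  have hτ : (τ : ℂ) ≠ 0 := τ.ne_zero
  have hs := s2C_ne_zero
  have h2 : (2 : ℂ) = (s2 : ℂ) * s2 := by exact_mod_cast s2_mul_s2.symm
  rw [h2]
  field_simp

/-- `scaleDown (√2 +ᵥ τ) = 1 +ᵥ scaleDown τ`. [folklore] -/
theorem scaleDown_vadd (τ : ℍ) : scaleDown ((s2 : ℝ) +ᵥ τ) = (1 : ℝ) +ᵥ scaleDown τ := by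
  apply UpperHalfPlane.ext
  rw [coe_scaleDown, UpperHalfPlane.coe_vadd, UpperHalfPlane.coe_vadd, coe_scaleDown]
  push_cast
  rw [add_div, div_self s2C_ne_zero]

/-- `scaleDown → i∞`. [folklore] -/
theorem tendsto_scaleDown_atImInfty : Tendsto scaleDown atImInfty atImInfty := by
  rw [atImInfty, tendsto_comap_iff]
  have : (UpperHalfPlane.im ∘ scaleDown) = fun τ => τ.im / s2 := funext fun τ => scaleDown_im τ
  rw [this]
  exact Filter.Tendsto.atTop_div_const s2_pos tendsto_comap

/-- `f₂ → 0` at `i∞`. [folklore] -/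
theorem tendsto_fTwo_atImInfty : Tendsto fTwo atImInfty (𝓝 0) := by
  have h := tendsto_deltaTwo.div (tendsto_eisTwo.pow 2) (by norm_num)
  rw [one_pow, zero_div] at h
  exact h.congr fun τ => rfl

/-- `f₂ ∘ ofComplex` is holomorphic at `w` with `Im w > 1/2`. [folklore] -/
theorem differentiableAt_fTwo {w : ℂ} (hw : 1 / 2 < w.im) : DifferentiableAt ℂ (fTwo ∘ ofComplex) w := by
  have hw0 : 0 < w.im := lt_trans (by norm_num) hw
  have hΔ := (UpperHalfPlane.mdifferentiable_iff.mp mdifferentiable_deltaTwo).differentiableAt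
    (isOpen_upperHalfPlaneSet.mem_nhds hw0)
  have hE := (UpperHalfPlane.mdifferentiable_iff.mp mdifferentiable_eisTwo).differentiableAt
    (isOpen_upperHalfPlaneSet.mem_nhds hw0)
  have hne : eisTwo (ofComplex w) ^ 2 ≠ 0 := by
    apply pow_ne_zero
    apply eisTwo_ne_zero_of_im_gt
    rwa [← UpperHalfPlane.coe_im, ofComplex_apply_of_im_pos hw0]
  exact (hΔ.div (hE.pow 2) hne).congr_of_eventuallyEq (Eventually.of_forall fun u => rfl)

/-- **The scaled level-two form** `g₂(v) := f₂(v/√2)`. [folklore] -/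
def gTwo (τ : ℍ) : ℂ := fTwo (scaleDown τ)

/-- **The level-two Hecke datum**: `g₂`, pole height `√2/2`, period `√2`. [folklore] -/
def dataTwo : HeckeFormData where
  g := gTwo
  a := s2 / 2
  per := s2
  a_pos := by positivity [s2_pos]
  a_lt_one := by linarith [s2_lt_two]
  per_pos := s2_pos
  per_le_two := s2_lt_two.le
  differentiableAt_g w hw := by
    have hw0 : 0 < w.im := lt_trans (by positivity [s2_pos]) hw
    have hw2 : 1 / 2 < (w / s2).im := by
      rw [Complex.div_ofReal_im, lt_div_iff₀ s2_pos]; linarith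
    have h1 := differentiableAt_fTwo hw2
    have h2 : DifferentiableAt ℂ (fun u : ℂ => u / s2) w := differentiableAt_id.div_const _
    have h := DifferentiableAt.comp (g := fTwo ∘ ofComplex) w h1 h2
    refine h.congr_of_eventuallyEq ?_
    filter_upwards [isOpen_upperHalfPlaneSet.mem_nhds hw0] with u hu
    simp only [Function.comp_apply, gTwo]
    rw [scaleDown_ofComplex hu]
  S_law τ := by
    rw [gTwo, gTwo, scaleDown_S_smul, fTwo_fricke, coe_scaleDown]
    have h2 : (s2 : ℂ) ^ 4 = 4 := by
      rw [show (4:ℕ) = 2 * 2 from rfl, pow_mul]; norm_cast; rw [s2_sq]; norm_num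
    field_simp
    rw [h2]; ring
  T_law τ := by rw [gTwo, gTwo, scaleDown_vadd, fTwo_vadd_one]
  tendsto_g := tendsto_fTwo_atImInfty.comp tendsto_scaleDown_atImInfty

/-- The pole height of `dataTwo`. [folklore] -/
@[simp] theorem dataTwo_a : dataTwo.a = s2 / 2 := rfl

/-- The period of `dataTwo`. [folklore] -/
@[simp] theorem dataTwo_per : dataTwo.per = s2 := rfl

/-- The function of `dataTwo`. [folklore] -/
@[simp] theorem dataTwo_g : dataTwo.g = gTwo := rfl

/-- `a = √2/2` satisfies `a·2 = √2` and `a · √2 = 1`. [folklore] -/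
theorem a_mul_s2 : s2 / 2 * s2 = 1 := by nlinarith [s2_mul_s2]

/-! ## 2. The corner `c₂ = (i − 1)/2`, its orbit and the fundamental domain -/

/-- Coordinates of `cmLevelTwo`. [folklore] -/
theorem cmLevelTwo_re : cmLevelTwo.re = -1 / 2 := by simp [cmLevelTwo, UpperHalfPlane.re]

/-- Coordinates of `cmLevelTwo`. [folklore] -/
theorem cmLevelTwo_im : cmLevelTwo.im = 1 / 2 := by simp [cmLevelTwo, UpperHalfPlane.im]

/-- Coordinates of `cmLevelTwo`. [folklore] -/
theorem coe_cmLevelTwo : ((cmLevelTwo : ℍ) : ℂ) = ⟨-1 / 2, 1 / 2⟩ := rfl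

/-- `|c₂|² = 1/2`. [folklore] -/
theorem normSq_cmLevelTwo : Complex.normSq ((cmLevelTwo : ℍ) : ℂ) = 1 / 2 := by
  rw [coe_cmLevelTwo, Complex.normSq_mk]; norm_num

/-- `c₂ ∈ 𝒟₂` (a corner). [folklore] -/
theorem cmLevelTwo_mem_fdTwo : cmLevelTwo ∈ fdTwo := by
  refine ⟨?_, by rw [normSq_cmLevelTwo]⟩
  rw [cmLevelTwo_re, abs_le]; constructor <;> norm_num

/-- `W₂ c₂ = c₂ + 1`. [folklore] -/
theorem frickeTwo_cmLevelTwo : frickeTwo cmLevelTwo = (1 : ℝ) +ᵥ cmLevelTwo := by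
  apply UpperHalfPlane.ext
  rw [coe_frickeTwo, UpperHalfPlane.coe_vadd, coe_cmLevelTwo]
  apply Complex.ext <;> simp [Complex.div_re, Complex.div_im, Complex.normSq_mk] <;> norm_num

/-- `c₂ + 1 = T • c₂`. [folklore] -/
theorem vadd_one_eq_T_smul (z : ℍ) : (1 : ℝ) +ᵥ z = ModularGroup.T • z := by
  rw [UpperHalfPlane.modular_T_smul]

/-- `T ∈ Γ₀(2)`. [folklore] -/
theorem T_mem_Gamma0_two : ModularGroup.T ∈ Gamma0 2 := by
  rw [mem_Gamma0_two_iff]; simp [ModularGroup.T]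

/-- The corner orbit. [folklore] -/
def cornerOrb : Set ℍ := orbTwo cmLevelTwo

/-- **The `Γ₀(2)`-orbit of `c₂` is its `Γ₀(2)⁺`-orbit** (`W₂c₂ = Tc₂`). [folklore] -/
theorem mem_orbit_iff_mem_cornerOrb (z : ℍ) :
    z ∈ MulAction.orbit (Gamma0 2) cmLevelTwo ↔ z ∈ cornerOrb := by
  constructor
  · rintro ⟨g, rfl⟩
    exact ⟨(g : SL(2, ℤ)), g.2, Or.inl rfl⟩
  · rintro ⟨γ, hγ, h | h⟩
    · exact ⟨⟨γ, hγ⟩, h.symm⟩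
    · refine ⟨⟨γ * ModularGroup.T, Subgroup.mul_mem _ hγ T_mem_Gamma0_two⟩, ?_⟩
      rw [h, frickeTwo_cmLevelTwo, vadd_one_eq_T_smul]
      simp [mul_smul]

/-- Orbit points of the corner have height `≤ 1/2`. [folklore] -/
theorem im_le_half_of_mem_cornerOrb {z : ℍ} (hz : z ∈ cornerOrb) : z.im ≤ 1 / 2 := by
  have := im_le_of_mem_orbTwo cmLevelTwo_mem_fdTwo hz
  rwa [cmLevelTwo_im] at this

/-- Membership in the corner orbit is a property of the orbit. [folklore] -/
theorem mem_cornerOrb_iff_of_mem_orbTwo {z u : ℍ} (hu : u ∈ orbTwo z) : u ∈ cornerOrb ↔ z ∈ cornerOrb := by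
  rw [cornerOrb]
  constructor
  · intro h
    have h1 : cmLevelTwo ∈ orbTwo u := mem_orbTwo_symm h
    rw [orbTwo_eq_of_mem hu] at h1
    exact mem_orbTwo_symm h1
  · intro h
    have h1 : cmLevelTwo ∈ orbTwo z := mem_orbTwo_symm h
    rw [← orbTwo_eq_of_mem hu] at h1
    exact mem_orbTwo_symm h1

/-- `γ • z` is in the corner orbit iff `z` is. [folklore] -/
theorem smul_mem_cornerOrb_iff {γ : SL(2, ℤ)} (hγ : γ ∈ Gamma0 2) (z : ℍ) :
    γ • z ∈ cornerOrb ↔ z ∈ cornerOrb :=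
  mem_cornerOrb_iff_of_mem_orbTwo (smul_mem_orbTwo hγ z)

/-- `W₂ z` is in the corner orbit iff `z` is. [folklore] -/
theorem frickeTwo_mem_cornerOrb_iff (z : ℍ) : frickeTwo z ∈ cornerOrb ↔ z ∈ cornerOrb :=
  mem_cornerOrb_iff_of_mem_orbTwo (frickeTwo_mem_orbTwo z)

/-- **Points of `𝒟₂` off the corner orbit have `Im > 1/2`.** [folklore] -/
theorem half_lt_im_of_mem_fdTwo {u : ℍ} (hu : u ∈ fdTwo) (hno : u ∉ cornerOrb) : 1 / 2 < u.im := by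
  rcases (half_le_im_of_mem_fdTwo hu).lt_or_eq with h | h
  · exact h
  · exfalso
    obtain ⟨hre, hn⟩ := corner_of_im_eq_half hu h.symm
    apply hno
    rcases hre with hr | hr
    · -- right corner `c₂ + 1 = W₂ c₂`
      have : u = frickeTwo cmLevelTwo := by
        rw [frickeTwo_cmLevelTwo]
        apply UpperHalfPlane.ext; apply Complex.ext
        · rw [UpperHalfPlane.coe_re, hr, UpperHalfPlane.coe_vadd, Complex.add_re, Complex.ofReal_re,
            coe_cmLevelTwo]; norm_num
        · rw [UpperHalfPlane.coe_im, ← h, UpperHalfPlane.coe_vadd, Complex.add_im, Complex.ofReal_im,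
            coe_cmLevelTwo]; norm_num
      rw [this]; exact frickeTwo_mem_orbTwo _
    · have : u = cmLevelTwo := by
        apply UpperHalfPlane.ext; apply Complex.ext
        · rw [UpperHalfPlane.coe_re, hr, coe_cmLevelTwo]; norm_num
        · rw [UpperHalfPlane.coe_im, ← h, coe_cmLevelTwo]
      rw [this]; exact mem_orbTwo_self _

/-! ## 3. The key compatibility lemma and the extension `FTwo` -/

/-- `√2 u` as a complex number. [folklore] -/
def sc (u : ℍ) : ℂ := (s2 : ℂ) * u

/-- Imaginary part of `√2 u`. [folklore] -/
theorem sc_im (u : ℍ) : (sc u).im = s2 * u.im := by rw [sc, Complex.mul_im]; simp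

/-- `a < Im(√2 u)` iff `1/2 < Im u`. [folklore] -/
theorem a_lt_sc_im {u : ℍ} (hu : 1 / 2 < u.im) : dataTwo.a < (sc u).im := by
  rw [dataTwo_a, sc_im]; nlinarith [s2_pos]

/-- `√2 (n +ᵥ u) = √2 u + n·√2`. [folklore] -/
theorem sc_vadd (n : ℤ) (u : ℍ) : sc (((n : ℝ)) +ᵥ u) = sc u + n * dataTwo.per := by
  rw [sc, sc, UpperHalfPlane.coe_vadd, dataTwo_per]; push_cast; ring

/-- `√2 · W₂ u = Sc (√2 u)`. [folklore] -/
theorem sc_frickeTwo (u : ℍ) : sc (frickeTwo u) = GreenRho.Sc (sc u) := by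
  rw [sc, sc, coe_frickeTwo, GreenRho.Sc]
  have hu : (u : ℂ) ≠ 0 := u.ne_zero
  have hs := s2C_ne_zero
  have h2 : (2 : ℂ) = (s2 : ℂ) * s2 := by exact_mod_cast s2_mul_s2.symm
  rw [h2]
  field_simp

/-- A point of `𝒟₂` with `Im > 1/2` on the arc `|u|² = 1/2` gives `√2u` in the lens. [folklore] -/
theorem sc_mem_lens {u : ℍ} (hu : 1 / 2 < u.im) (hn : Complex.normSq (u : ℂ) < u.im) : sc u ∈ dataTwo.lens := by
  refine ⟨a_lt_sc_im hu, ?_⟩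
  rw [dataTwo_a, sc_im, sc, Complex.normSq_mul, Complex.normSq_ofReal, s2_mul_s2]
  nlinarith [s2_pos]

section KeyLemma

variable (hreal : (dataTwo.M₁ Complex.I).im = 0)
include hreal

/-- **Key lemma**: two `𝒟₂`-representatives of one `Γ₀(2)⁺`-orbit, off the corner orbit, give the
same value of `Fbase ∘ √2`. [folklore] -/
theorem Fbase_sc_eq_of_mem_fdTwo {u v : ℍ} (hu : u ∈ fdTwo) (hv : v ∈ fdTwo) (hvu : v ∈ orbTwo u)
    (hno : u ∉ cornerOrb) : dataTwo.Fbase (sc v) = dataTwo.Fbase (sc u) := by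
  have him_u : 1 / 2 < u.im := half_lt_im_of_mem_fdTwo hu hno
  have h1 : v.im ≤ u.im := im_le_of_mem_orbTwo hu hvu
  have h2 : u.im ≤ v.im := im_le_of_mem_orbTwo hv (mem_orbTwo_symm hvu)
  have heq : v.im = u.im := le_antisymm h1 h2
  obtain ⟨γ, hγ, h | h⟩ := hvu
  · have him : (γ • u).im = u.im := by rw [← h]; exact heq
    obtain ⟨n, hn⟩ := eq_vadd_of_im_eq hu him_u γ hγ him
    rw [h, hn, sc_vadd]
    exact dataTwo.Fbase_add_int_mul_per (a_lt_sc_im him_u) n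
  · have him : (γ • frickeTwo u).im = u.im := by rw [← h]; exact heq
    obtain ⟨hnorm, n, hn⟩ := eq_vadd_fricke_of_im_eq hu him_u γ hγ him
    have hWim : 1 / 2 < (frickeTwo u).im := by
      rw [im_frickeTwo, hnorm]; simpa using him_u
    rw [h, hn, sc_vadd, dataTwo.Fbase_add_int_mul_per (a_lt_sc_im hWim) n, sc_frickeTwo]
    apply dataTwo.Fbase_Sc _ hreal
    exact sc_mem_lens him_u (by rw [hnorm]; exact him_u)

end KeyLemma

/-- A chosen `𝒟₂`-representative of the orbit of `z`. [folklore] -/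
def repTwo (z : ℍ) : ℍ := Classical.choose (exists_mem_orbTwo_mem_fdTwo z)

/-- The representative lies in the orbit. [folklore] -/
theorem repTwo_mem_orbTwo (z : ℍ) : repTwo z ∈ orbTwo z := (Classical.choose_spec (exists_mem_orbTwo_mem_fdTwo z)).1

/-- The representative lies in `𝒟₂`. [folklore] -/
theorem repTwo_mem_fdTwo (z : ℍ) : repTwo z ∈ fdTwo := (Classical.choose_spec (exists_mem_orbTwo_mem_fdTwo z)).2

open Classical in
/-- **The extension** `FTwo z := Fbase(√2 · rep z)` off the corner orbit, `0` on it. [folklore] -/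
def FTwo (z : ℍ) : ℝ := if z ∈ cornerOrb then 0 else dataTwo.Fbase (sc (repTwo z))

section Extension

variable (hreal : (dataTwo.M₁ Complex.I).im = 0)
include hreal

/-- `FTwo z = Fbase(√2 u)` for ANY `𝒟₂`-representative `u` of the orbit of `z`. [folklore] -/
theorem FTwo_eq_of_rep {z u : ℍ} (hz : z ∉ cornerOrb) (hu : u ∈ orbTwo z) (hfd : u ∈ fdTwo) :
    FTwo z = dataTwo.Fbase (sc u) := by
  rw [FTwo, if_neg hz]
  have huno : u ∉ cornerOrb := fun h => hz ((mem_cornerOrb_iff_of_mem_orbTwo hu).mp h)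
  have hrep : repTwo z ∈ orbTwo u := by
    rw [orbTwo_eq_of_mem hu]; exact repTwo_mem_orbTwo z
  exact Fbase_sc_eq_of_mem_fdTwo hreal hfd (repTwo_mem_fdTwo z) hrep huno

/-- **`FTwo` is `Γ₀(2)`-invariant.** [folklore] -/
theorem FTwo_smul {γ : SL(2, ℤ)} (hγ : γ ∈ Gamma0 2) (z : ℍ) : FTwo (γ • z) = FTwo z := by
  by_cases hz : z ∈ cornerOrb
  · rw [FTwo, FTwo, if_pos hz, if_pos ((smul_mem_cornerOrb_iff hγ z).mpr hz)]
  · have hz' : γ • z ∉ cornerOrb := fun h => hz ((smul_mem_cornerOrb_iff hγ z).mp h)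
    have hu : repTwo z ∈ orbTwo (γ • z) := by rw [orbTwo_smul hγ]; exact repTwo_mem_orbTwo z
    rw [FTwo_eq_of_rep hreal hz' hu (repTwo_mem_fdTwo z), FTwo, if_neg hz]

/-- **`FTwo` is `W₂`-invariant.** [folklore] -/
theorem FTwo_frickeTwo (z : ℍ) : FTwo (frickeTwo z) = FTwo z := by
  by_cases hz : z ∈ cornerOrb
  · rw [FTwo, FTwo, if_pos hz, if_pos ((frickeTwo_mem_cornerOrb_iff z).mpr hz)]
  · have hz' : frickeTwo z ∉ cornerOrb := fun h => hz ((frickeTwo_mem_cornerOrb_iff z).mp h)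
    have hu : repTwo z ∈ orbTwo (frickeTwo z) := by rw [orbTwo_frickeTwo]; exact repTwo_mem_orbTwo z
    rw [FTwo_eq_of_rep hreal hz' hu (repTwo_mem_fdTwo z), FTwo, if_neg hz]

/-- `FTwo` is invariant under integer translations. [folklore] -/
theorem FTwo_vadd_int (n : ℤ) (z : ℍ) : FTwo (((n : ℝ)) +ᵥ z) = FTwo z := by
  have h : ((n : ℝ)) +ᵥ z = (ModularGroup.T ^ n) • z := by rw [UpperHalfPlane.modular_T_zpow_smul]
  rw [h]
  apply FTwo_smul hreal
  rw [mem_Gamma0_two_iff, ModularGroup.coe_T_zpow]; simp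

end Extension

/-! ## 4. Local charts and regularity -/

section Regularity

variable (hreal : (dataTwo.M₁ Complex.I).im = 0)
include hreal

omit hreal in
/-- `ofComplex u` off the corner orbit when `Im u > 1/2`. [folklore] -/
theorem notMem_cornerOrb_of_im {u : ℂ} (hu : 1 / 2 < u.im) : ofComplex u ∉ cornerOrb := fun h => by
  have := im_le_half_of_mem_cornerOrb h
  rw [← UpperHalfPlane.coe_im, ofComplex_apply_of_im_pos (by linarith)] at this
  linarith

/-- **Local chart**: near a point `u₀ ∈ 𝒟₂` off the corner orbit, `FTwo ∘ ofComplex = Fbase ∘ √2`. [folklore] -/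
theorem FTwo_ofComplex_eventuallyEq {u₀ : ℍ} (hu₀ : u₀ ∈ fdTwo) (hno : u₀ ∉ cornerOrb) :
    (fun u : ℂ => FTwo (ofComplex u)) =ᶠ[𝓝 (u₀ : ℂ)] fun u => dataTwo.Fbase ((s2 : ℂ) * u) := by
  have him : 1 / 2 < u₀.im := half_lt_im_of_mem_fdTwo hu₀ hno
  suffices h : ∀ᶠ u in 𝓝 (u₀ : ℂ), 1 / 2 < u.im ∧
      ∃ v : ℍ, v ∈ orbTwo (ofComplex u) ∧ v ∈ fdTwo ∧ dataTwo.Fbase (sc v) = dataTwo.Fbase ((s2 : ℂ) * u) by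
    filter_upwards [h] with u ⟨hu, v, hv, hfd, hF⟩
    rw [FTwo_eq_of_rep hreal (notMem_cornerOrb_of_im hu) hv hfd, hF]
  have hc_im : ∀ᶠ u in 𝓝 (u₀ : ℂ), 1 / 2 < u.im :=
    Complex.continuous_im.continuousAt.eventually (lt_mem_nhds (by simpa using him))
  have hre0 : |u₀.re| ≤ 1 / 2 := hu₀.1
  have hn0 : 1 / 2 ≤ Complex.normSq (u₀ : ℂ) := hu₀.2
  have hsc : ∀ u : ℂ, 0 < u.im → sc (ofComplex u) = (s2 : ℂ) * u := fun u hu => by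
    rw [sc, ofComplex_apply_of_im_pos hu]
  by_cases hint : |u₀.re| < 1 / 2 ∧ 1 / 2 < Complex.normSq (u₀ : ℂ)
  · have h1 : ∀ᶠ u in 𝓝 (u₀ : ℂ), |u.re| < 1 / 2 :=
      (continuous_abs.comp Complex.continuous_re).continuousAt.eventually
        (gt_mem_nhds (by simpa using hint.1))
    have h2 : ∀ᶠ u in 𝓝 (u₀ : ℂ), 1 / 2 < Complex.normSq u :=
      Complex.continuous_normSq.continuousAt.eventually (lt_mem_nhds hint.2)
    filter_upwards [hc_im, h1, h2] with u hu h1 h2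
    have hu0 : 0 < u.im := lt_trans (by norm_num) hu
    refine ⟨hu, ofComplex u, mem_orbTwo_self _, ⟨?_, ?_⟩, by rw [hsc u hu0]⟩
    · rw [show (ofComplex u).re = u.re by rw [← UpperHalfPlane.coe_re, ofComplex_apply_of_im_pos hu0]]
      exact h1.le
    · rw [ofComplex_apply_of_im_pos hu0]; exact h2.le
  · push Not at hint
    by_cases hre : |u₀.re| < 1 / 2
    · -- on the arc `normSq u₀ = 1/2`: use `W₂` when `normSq u < 1/2`
      have hn1 : Complex.normSq (u₀ : ℂ) = 1 / 2 := le_antisymm (hint hre) hn0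
      have h1 : ∀ᶠ u in 𝓝 (u₀ : ℂ), |u.re| < 1 / 2 :=
        (continuous_abs.comp Complex.continuous_re).continuousAt.eventually
          (gt_mem_nhds (by simpa using hre))
      -- `|Re(W₂ u)| = |Re u|/(2 normSq u) < 1/2` near `u₀`
      have h2 : ∀ᶠ u in 𝓝 (u₀ : ℂ), |u.re| < Complex.normSq u := by
        have hc : Continuous fun u : ℂ => Complex.normSq u - |u.re| := by fun_prop
        have h0 : 0 < Complex.normSq (u₀ : ℂ) - |(u₀ : ℂ).re| := by
          rw [hn1, UpperHalfPlane.coe_re]; linarith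
        filter_upwards [hc.continuousAt.eventually (lt_mem_nhds h0)] with u hu
        linarith
      have h3 : ∀ᶠ u in 𝓝 (u₀ : ℂ), Complex.normSq u < u.im := by
        have hc : Continuous fun u : ℂ => u.im - Complex.normSq u := by fun_prop
        have h0 : 0 < (u₀ : ℂ).im - Complex.normSq (u₀ : ℂ) := by
          rw [hn1, UpperHalfPlane.coe_im]; linarith
        filter_upwards [hc.continuousAt.eventually (lt_mem_nhds h0)] with u hu
        linarith
      filter_upwards [hc_im, h1, h2, h3] with u hu h1 h2 h3
      have hu0 : 0 < u.im := lt_trans (by norm_num) hu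
      have hcoe : ((ofComplex u : ℍ) : ℂ) = u := by rw [ofComplex_apply_of_im_pos hu0]
      refine ⟨hu, ?_⟩
      by_cases hn : 1 / 2 ≤ Complex.normSq u
      · refine ⟨ofComplex u, mem_orbTwo_self _, ⟨?_, by rwa [hcoe]⟩, by rw [hsc u hu0]⟩
        rw [show (ofComplex u).re = u.re by rw [← UpperHalfPlane.coe_re, hcoe]]; exact h1.le
      · push Not at hn
        have hnpos : 0 < Complex.normSq u := Complex.normSq_pos.mpr (by rintro rfl; simp at hu0)
        have hu0' : u ≠ 0 := by rintro rfl; simp at hu0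
        have himU : (ofComplex u).im = u.im := by rw [← UpperHalfPlane.coe_im, hcoe]
        refine ⟨frickeTwo (ofComplex u), frickeTwo_mem_orbTwo _, ⟨?_, ?_⟩, ?_⟩
        · rw [← UpperHalfPlane.coe_re, coe_frickeTwo, hcoe]
          have e : (-1 / (2 * u)).re = -(1 / 2) * (u.re / Complex.normSq u) := by
            have : (-1 / (2 * u) : ℂ) = ((-(1 / 2) : ℝ) : ℂ) * u⁻¹ := by
              rw [div_eq_mul_inv, mul_inv]; push_cast; ring
            rw [this, Complex.re_ofReal_mul, Complex.inv_re]
          have h2n : (0 : ℝ) < 2 * Complex.normSq u := by linarith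
          rw [e, show -(1 / 2) * (u.re / Complex.normSq u) = -u.re / (2 * Complex.normSq u) by
            field_simp, abs_div, abs_neg, abs_of_pos h2n, div_le_iff₀ h2n]
          linarith
        · rw [normSq_frickeTwo, hcoe]
          rw [le_div_iff₀ (by linarith), ← sub_nonneg]
          nlinarith
        · rw [sc_frickeTwo, hsc u hu0]
          have hlens : (s2 : ℂ) * u ∈ dataTwo.lens := by
            have := sc_mem_lens (u := ofComplex u) (by rw [himU]; exact hu) (by rw [hcoe, himU]; exact h3)
            rwa [hsc u hu0] at this
          exact dataTwo.Fbase_Sc hlens hreal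
    · -- on a vertical side
      push Not at hre
      have hre12 : |u₀.re| = 1 / 2 := le_antisymm hre0 hre
      have hn1 : 1 / 2 < Complex.normSq (u₀ : ℂ) := by
        by_contra hcon
        push Not at hcon
        have hn1 : Complex.normSq (u₀ : ℂ) = 1 / 2 := le_antisymm hcon hn0
        have him2 : u₀.im = 1 / 2 := by
          rw [Complex.normSq_apply, UpperHalfPlane.coe_re, UpperHalfPlane.coe_im] at hn1
          have : u₀.re ^ 2 = 1 / 4 := by rw [← sq_abs, hre12]; norm_num
          nlinarith [u₀.im_pos]
        linarith
      rcases (abs_eq (by norm_num : (0:ℝ) ≤ 1/2)).mp hre12 with hr | hr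
      · -- right side: use `T⁻¹` when `re u > 1/2`
        have h1 : ∀ᶠ u in 𝓝 (u₀ : ℂ), 0 < u.re ∧ u.re < 1 := by
          have e : (u₀ : ℂ).re = 1 / 2 := by rw [UpperHalfPlane.coe_re, hr]
          have ha := Complex.continuous_re.continuousAt.eventually (lt_mem_nhds (show (0:ℝ) < (u₀:ℂ).re by rw [e]; norm_num))
          have hb := Complex.continuous_re.continuousAt.eventually (gt_mem_nhds (show (u₀:ℂ).re < 1 by rw [e]; norm_num))
          exact ha.and hb
        have h2 : ∀ᶠ u in 𝓝 (u₀ : ℂ), 1 / 2 < Complex.normSq u :=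
          Complex.continuous_normSq.continuousAt.eventually (lt_mem_nhds hn1)
        have h3 : ∀ᶠ u in 𝓝 (u₀ : ℂ), 1 / 2 < Complex.normSq (u - 1) := by
          have hc : Continuous fun u : ℂ => Complex.normSq (u - 1) := by fun_prop
          have h0 : 1 / 2 < Complex.normSq ((u₀ : ℂ) - 1) := by
            have e : Complex.normSq ((u₀ : ℂ) - 1) = Complex.normSq (u₀ : ℂ) - 2 * u₀.re + 1 := by
              simp [Complex.normSq_apply]; ring
            rw [e, hr]; linarith
          exact hc.continuousAt.eventually (lt_mem_nhds h0)
        filter_upwards [hc_im, h1, h2, h3] with u hu h1 h2 h3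
        have hu0 : 0 < u.im := lt_trans (by norm_num) hu
        have hcoe : ((ofComplex u : ℍ) : ℂ) = u := by rw [ofComplex_apply_of_im_pos hu0]
        refine ⟨hu, ?_⟩
        by_cases hru : u.re ≤ 1 / 2
        · refine ⟨ofComplex u, mem_orbTwo_self _, ⟨?_, by rw [hcoe]; exact h2.le⟩, by rw [hsc u hu0]⟩
          rw [show (ofComplex u).re = u.re by rw [← UpperHalfPlane.coe_re, hcoe], abs_le]
          exact ⟨by linarith [h1.1], hru⟩
        · push Not at hru
          refine ⟨(((-1 : ℤ) : ℝ)) +ᵥ ofComplex u, vadd_int_mem_orbTwo _ _, ⟨?_, ?_⟩, ?_⟩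
          · rw [UpperHalfPlane.vadd_re, show (ofComplex u).re = u.re by rw [← UpperHalfPlane.coe_re, hcoe], abs_le]
            push_cast
            exact ⟨by linarith, by linarith [h1.2]⟩
          · rw [UpperHalfPlane.coe_vadd, hcoe]; push_cast
            rw [show (-1 : ℂ) + u = u - 1 by ring]; exact h3.le
          · rw [sc_vadd, hsc u hu0]
            exact dataTwo.Fbase_add_int_mul_per (w := (s2 : ℂ) * u)
              (by rw [dataTwo_a, Complex.mul_im]; simp; nlinarith [s2_pos]) (-1)
      · -- left side: use `T` when `re u < -1/2`
        have h1 : ∀ᶠ u in 𝓝 (u₀ : ℂ), -1 < u.re ∧ u.re < 0 := by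
          have e : (u₀ : ℂ).re = -(1 / 2) := by rw [UpperHalfPlane.coe_re, hr]
          have ha := Complex.continuous_re.continuousAt.eventually (lt_mem_nhds (show (-1:ℝ) < (u₀:ℂ).re by rw [e]; norm_num))
          have hb := Complex.continuous_re.continuousAt.eventually (gt_mem_nhds (show (u₀:ℂ).re < 0 by rw [e]; norm_num))
          exact ha.and hb
        have h2 : ∀ᶠ u in 𝓝 (u₀ : ℂ), 1 / 2 < Complex.normSq u :=
          Complex.continuous_normSq.continuousAt.eventually (lt_mem_nhds hn1)
        have h3 : ∀ᶠ u in 𝓝 (u₀ : ℂ), 1 / 2 < Complex.normSq (u + 1) := by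
          have hc : Continuous fun u : ℂ => Complex.normSq (u + 1) := by fun_prop
          have h0 : 1 / 2 < Complex.normSq ((u₀ : ℂ) + 1) := by
            have e : Complex.normSq ((u₀ : ℂ) + 1) = Complex.normSq (u₀ : ℂ) + 2 * u₀.re + 1 := by
              simp [Complex.normSq_apply]; ring
            rw [e, hr]; linarith
          exact hc.continuousAt.eventually (lt_mem_nhds h0)
        filter_upwards [hc_im, h1, h2, h3] with u hu h1 h2 h3
        have hu0 : 0 < u.im := lt_trans (by norm_num) hu
        have hcoe : ((ofComplex u : ℍ) : ℂ) = u := by rw [ofComplex_apply_of_im_pos hu0]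
        refine ⟨hu, ?_⟩
        by_cases hru : -(1 / 2) ≤ u.re
        · refine ⟨ofComplex u, mem_orbTwo_self _, ⟨?_, by rw [hcoe]; exact h2.le⟩, by rw [hsc u hu0]⟩
          rw [show (ofComplex u).re = u.re by rw [← UpperHalfPlane.coe_re, hcoe], abs_le]
          exact ⟨hru, by linarith [h1.2]⟩
        · push Not at hru
          refine ⟨(((1 : ℤ) : ℝ)) +ᵥ ofComplex u, vadd_int_mem_orbTwo _ _, ⟨?_, ?_⟩, ?_⟩
          · rw [UpperHalfPlane.vadd_re, show (ofComplex u).re = u.re by rw [← UpperHalfPlane.coe_re, hcoe], abs_le]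
            push_cast
            exact ⟨by linarith [h1.1], by linarith⟩
          · rw [UpperHalfPlane.coe_vadd, hcoe]; push_cast
            rw [show (1 : ℂ) + u = u + 1 by ring]; exact h3.le
          · rw [sc_vadd, hsc u hu0]
            exact dataTwo.Fbase_add_int_mul_per (w := (s2 : ℂ) * u)
              (by rw [dataTwo_a, Complex.mul_im]; simp; nlinarith [s2_pos]) 1


omit hreal in
/-- The scaled Möbius chart `μ(w) = √2·(γ•w)`: holomorphic near `z`, with
`(Im z)²‖μ'(z)‖² = (Im μ(z))²`. [folklore] -/
theorem chart_smul_facts (γ : SL(2, ℤ)) (z : ℍ) :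
    (∀ᶠ w in 𝓝 (z : ℂ), DifferentiableAt ℂ (fun w : ℂ => (s2 : ℂ) * ((γ • ofComplex w : ℍ) : ℂ)) w) ∧
      deriv (fun w : ℂ => (s2 : ℂ) * ((γ • ofComplex w : ℍ) : ℂ)) z =
        (s2 : ℂ) * (1 / denom (γ : GL (Fin 2) ℝ) z ^ 2) ∧
      z.im ^ 2 * ‖(s2 : ℂ) * (1 / denom (γ : GL (Fin 2) ℝ) z ^ 2)‖ ^ 2 =
        (((s2 : ℂ) * ((γ • z : ℍ) : ℂ)).im) ^ 2 := by
  obtain ⟨hdiff, hderiv⟩ := GreenRho.moebius_facts γ z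
  refine ⟨?_, ?_, ?_⟩
  · filter_upwards [hdiff] with w hw using hw.const_mul _
  · rw [deriv_const_mul _ hdiff.self_of_nhds, hderiv]
  · have hden : denom (γ : GL (Fin 2) ℝ) z ≠ 0 := UpperHalfPlane.denom_ne_zero _ z
    have himu : ((s2 : ℂ) * ((γ • z : ℍ) : ℂ)).im = s2 * (z.im / Complex.normSq (denom (γ : GL (Fin 2) ℝ) z)) := by
      rw [Complex.mul_im, Complex.ofReal_re, Complex.ofReal_im, zero_mul, add_zero, UpperHalfPlane.coe_im,
        ModularGroup.im_smul_eq_div_normSq]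
    rw [himu]
    have hnorm : ‖(s2 : ℂ) * (1 / denom (γ : GL (Fin 2) ℝ) z ^ 2)‖ ^ 2 =
        2 / Complex.normSq (denom (γ : GL (Fin 2) ℝ) z) ^ 2 := by
      rw [norm_mul, Complex.norm_real, Real.norm_eq_abs, abs_of_pos s2_pos, norm_div, norm_one, norm_pow,
        Complex.normSq_eq_norm_sq, mul_pow, s2_sq]; ring
    rw [hnorm]
    have hn0 : Complex.normSq (denom (γ : GL (Fin 2) ℝ) z) ≠ 0 := by rwa [Ne, Complex.normSq_eq_zero]
    field_simp
    linarith [s2_sq]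

omit hreal in
/-- The Fricke chart `κ(w) = −1/(2w)`: `ofComplex ∘ κ = W₂ ∘ ofComplex` on `ℍ`, holomorphic near
`z ∈ ℍ`, with derivative `1/(2z²)` and `(Im z)²‖κ'(z)‖² = (Im κ(z))²`. [folklore] -/
theorem kappa_facts (z : ℍ) :
    (∀ w : ℂ, 0 < w.im → ofComplex (-1 / (2 * w)) = frickeTwo (ofComplex w)) ∧
      (∀ᶠ w in 𝓝 (z : ℂ), DifferentiableAt ℂ (fun w : ℂ => -1 / (2 * w)) w) ∧
      HasDerivAt (fun w : ℂ => -1 / (2 * w)) (1 / (2 * (z : ℂ) ^ 2)) z ∧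
      (-1 / (2 * (z : ℂ))) = ((frickeTwo z : ℍ) : ℂ) ∧
      z.im ^ 2 * ‖1 / (2 * (z : ℂ) ^ 2)‖ ^ 2 = ((frickeTwo z : ℍ).im) ^ 2 := by
  have hz : (z : ℂ) ≠ 0 := z.ne_zero
  have hd : ∀ w : ℂ, w ≠ 0 → HasDerivAt (fun w : ℂ => -1 / (2 * w)) (1 / (2 * w ^ 2)) w := by
    intro w hw
    have := ((hasDerivAt_inv hw).const_mul (-(1 / 2 : ℂ)))
    refine (this.congr_of_eventuallyEq (Eventually.of_forall fun v => ?_)).congr_deriv ?_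
    · show -1 / (2 * v) = -(1 / 2) * v⁻¹
      rw [div_eq_mul_inv, mul_inv]; ring
    · field_simp
  refine ⟨fun w hw => ?_, ?_, hd _ hz, by rw [coe_frickeTwo], ?_⟩
  · apply UpperHalfPlane.ext
    have hw' : 0 < (-1 / (2 * w)).im := by
      have e : (-1 / (2 * w) : ℂ) = ((-(1 / 2) : ℝ) : ℂ) * w⁻¹ := by
        rw [div_eq_mul_inv, mul_inv]; push_cast; ring
      rw [e, Complex.im_ofReal_mul, Complex.inv_im]
      have hn : 0 < Complex.normSq w := Complex.normSq_pos.mpr (by rintro rfl; simp at hw)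
      have : -w.im / Complex.normSq w < 0 := div_neg_of_neg_of_pos (by linarith) hn
      nlinarith
    rw [ofComplex_apply_of_im_pos hw', coe_frickeTwo, ofComplex_apply_of_im_pos hw]
  · filter_upwards [isOpen_ne.mem_nhds hz] with w hw using (hd w hw).differentiableAt
  · rw [im_frickeTwo, norm_div, norm_one, norm_mul, Complex.norm_two, norm_pow, Complex.normSq_eq_norm_sq]
    have hn : ‖(z : ℂ)‖ ≠ 0 := norm_ne_zero_iff.mpr hz
    field_simp

/-- **`FTwo` is `C²` and `(Im z)² Δ (FTwo ∘ ofComplex)(z) = 2 FTwo(z)` off the corner orbit.** [folklore] -/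
theorem contDiffAt_laplacian_FTwo {z : ℍ} (hz : z ∉ cornerOrb) :
    ContDiffAt ℝ 2 (fun w : ℂ => FTwo (ofComplex w)) (z : ℂ) ∧
      realHypLaplacian FTwo z = (2 : ℝ) * ((2 : ℝ) - 1) * FTwo z := by
  set u₀ : ℍ := repTwo z with hu₀
  have hu₀fd : u₀ ∈ fdTwo := repTwo_mem_fdTwo z
  have hu₀orb : u₀ ∈ orbTwo z := repTwo_mem_orbTwo z
  have hu₀no : u₀ ∉ cornerOrb := fun h => hz ((mem_cornerOrb_iff_of_mem_orbTwo hu₀orb).mp h)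
  have hchart := FTwo_ofComplex_eventuallyEq hreal hu₀fd hu₀no
  have him0 : 1 / 2 < u₀.im := half_lt_im_of_mem_fdTwo hu₀fd hu₀no
  obtain ⟨γ, hγ, hcase⟩ := hu₀orb
  -- Case A at a general base point `x` with `γ • x = u₀`
  have caseA : ∀ x : ℍ, γ • x = u₀ →
      ((fun w : ℂ => FTwo (ofComplex w)) =ᶠ[𝓝 (x : ℂ)]
        dataTwo.Fbase ∘ fun w : ℂ => (s2 : ℂ) * ((γ • ofComplex w : ℍ) : ℂ)) ∧
      (∀ᶠ w in 𝓝 (x : ℂ), DifferentiableAt ℂ (fun w : ℂ => (s2 : ℂ) * ((γ • ofComplex w : ℍ) : ℂ)) w) ∧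
      dataTwo.a < ((s2 : ℂ) * ((γ • ofComplex (x : ℂ) : ℍ) : ℂ)).im ∧
      x.im ^ 2 * ‖deriv (fun w : ℂ => (s2 : ℂ) * ((γ • ofComplex w : ℍ) : ℂ)) x‖ ^ 2 =
        (((s2 : ℂ) * ((γ • ofComplex (x : ℂ) : ℍ) : ℂ)).im) ^ 2 := by
    intro x hx
    obtain ⟨hdiff, hderiv, hiso⟩ := chart_smul_facts γ x
    have hμcont : ContinuousAt (fun w : ℂ => ((γ • ofComplex w : ℍ) : ℂ)) (x : ℂ) :=
      (GreenRho.moebius_facts γ x).1.self_of_nhds.continuousAt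
    have hμx : ((γ • ofComplex (x : ℂ) : ℍ) : ℂ) = (u₀ : ℂ) := by simp [hx]
    refine ⟨?_, hdiff, ?_, ?_⟩
    · have h1 : ∀ᶠ w in 𝓝 (x : ℂ), FTwo (ofComplex ((γ • ofComplex w : ℍ) : ℂ)) =
          dataTwo.Fbase ((s2 : ℂ) * ((γ • ofComplex w : ℍ) : ℂ)) := by
        have := hμcont.eventually (show ∀ᶠ u in 𝓝 ((γ • ofComplex (x : ℂ) : ℍ) : ℂ),
          FTwo (ofComplex u) = dataTwo.Fbase ((s2 : ℂ) * u) by rw [hμx]; exact hchart)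
        exact this
      filter_upwards [h1] with w hw
      rw [Function.comp_apply, ← hw, ofComplex_apply, FTwo_smul hreal hγ]
    · rw [hμx, dataTwo_a]
      simp only [Complex.mul_im, Complex.ofReal_re, Complex.ofReal_im, zero_mul, add_zero, UpperHalfPlane.coe_im]
      nlinarith [s2_pos]
    · rw [hderiv]
      simpa only [ofComplex_apply] using hiso
  rcases hcase with h | h
  · obtain ⟨hloc, hμ, him, hiso⟩ := caseA z h.symm
    exact dataTwo.laplacian_of_chart hloc hμ him hiso
  · -- Case B: `u₀ = γ • W₂ z`; compose the chart at `z' = W₂ z` with `κ`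
    set z' : ℍ := frickeTwo z with hz'
    obtain ⟨hloc₁, hμ₁, him₁, hiso₁⟩ := caseA z' h.symm
    obtain ⟨hκof, hκdiff, hκd, hκz, hκiso⟩ := kappa_facts z
    set μ₁ : ℂ → ℂ := fun w => (s2 : ℂ) * ((γ • ofComplex w : ℍ) : ℂ) with hμ₁def
    set κ : ℂ → ℂ := fun w => -1 / (2 * w) with hκdef
    have hκz' : κ (z : ℂ) = (z' : ℂ) := hκz
    have hκcont : ContinuousAt κ (z : ℂ) := hκd.continuousAt
    have hloc : (fun w : ℂ => FTwo (ofComplex w)) =ᶠ[𝓝 (z : ℂ)] dataTwo.Fbase ∘ (μ₁ ∘ κ) := by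
      have h1 : ∀ᶠ w in 𝓝 (z : ℂ), FTwo (ofComplex (κ w)) = dataTwo.Fbase (μ₁ (κ w)) := by
        have := hκcont.eventually (show ∀ᶠ u in 𝓝 (κ (z : ℂ)), FTwo (ofComplex u) = (dataTwo.Fbase ∘ μ₁) u by
          rw [hκz']; exact hloc₁)
        exact this
      filter_upwards [h1, isOpen_upperHalfPlaneSet.mem_nhds z.im_pos] with w hw hwpos
      simp only [Function.comp_apply]
      rw [← hw, hκdef]
      simp only
      rw [hκof w hwpos, FTwo_frickeTwo hreal]
    have hμ : ∀ᶠ w in 𝓝 (z : ℂ), DifferentiableAt ℂ (μ₁ ∘ κ) w := by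
      have h1 : ∀ᶠ w in 𝓝 (z : ℂ), DifferentiableAt ℂ μ₁ (κ w) :=
        hκcont.eventually (show ∀ᶠ u in 𝓝 (κ (z : ℂ)), DifferentiableAt ℂ μ₁ u by rw [hκz']; exact hμ₁)
      filter_upwards [h1, hκdiff] with w h1 h2 using h1.comp w h2
    have hderiv : deriv (μ₁ ∘ κ) z = deriv μ₁ (z' : ℂ) * (1 / (2 * (z : ℂ) ^ 2)) := by
      have h1 : DifferentiableAt ℂ μ₁ (κ (z : ℂ)) := by rw [hκz']; exact hμ₁.self_of_nhds
      rw [deriv_comp (z : ℂ) h1 hκd.differentiableAt, hκd.deriv, hκz']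
    refine dataTwo.laplacian_of_chart hloc hμ ?_ ?_
    · show dataTwo.a < (μ₁ (κ (z : ℂ))).im
      rw [hκz']; exact him₁
    · show z.im ^ 2 * ‖deriv (μ₁ ∘ κ) (z : ℂ)‖ ^ 2 = ((μ₁ (κ (z : ℂ))).im) ^ 2
      rw [hderiv, hκz', norm_mul, mul_pow, ← hiso₁]
      have e : (z' : ℍ).im ^ 2 = z.im ^ 2 * ‖1 / (2 * (z : ℂ) ^ 2)‖ ^ 2 := by rw [hz']; exact hκiso.symm
      rw [e]; ring

end Regularity

/-! ## 5. The cusp bound and `IsResolventGreenLike 2 2 cmLevelTwo FTwo` -/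

section Cusp

variable (hreal : (dataTwo.M₁ Complex.I).im = 0)
include hreal

/-- For `Im w ≥ 1`, `FTwo w = Fbase(√2 (w + n))` with `|Re(w + n)| ≤ 1/2`. [folklore] -/
theorem FTwo_eq_Fbase_translate {w : ℍ} (hw : 1 ≤ w.im) :
    ∃ n : ℤ, FTwo w = dataTwo.Fbase (sc (((n : ℝ)) +ᵥ w)) := by
  set n : ℤ := -⌊w.re + 1 / 2⌋ with hn
  have h1 : ((⌊w.re + 1 / 2⌋ : ℤ) : ℝ) ≤ w.re + 1 / 2 := Int.floor_le _
  have h2 : w.re + 1 / 2 < ((⌊w.re + 1 / 2⌋ : ℤ) : ℝ) + 1 := Int.lt_floor_add_one _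
  refine ⟨n, ?_⟩
  have hno : w ∉ cornerOrb := fun h => by have := im_le_half_of_mem_cornerOrb h; linarith
  apply FTwo_eq_of_rep hreal hno (vadd_int_mem_orbTwo w n)
  refine ⟨?_, ?_⟩
  · rw [UpperHalfPlane.vadd_re, hn, abs_le]; push_cast; constructor <;> linarith
  · rw [Complex.normSq_apply, UpperHalfPlane.coe_re, UpperHalfPlane.coe_im, UpperHalfPlane.vadd_im]
    nlinarith [sq_nonneg ((((n : ℝ)) +ᵥ w).re)]

/-- **High in the cusp**: `|FTwo w| · Im w ≤ C` for `Im w ≥ √2`. [folklore] -/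
theorem exists_FTwo_cusp_bound : ∃ C : ℝ, 0 ≤ C ∧ ∀ w : ℍ, s2 ≤ w.im → |FTwo w| * w.im ≤ C := by
  obtain ⟨C, hC⟩ := dataTwo.exists_Fbase_cusp_bound'
  refine ⟨max (C / s2) 0, le_max_right _ _, fun w hw => ?_⟩
  have hw1 : 1 ≤ w.im := le_trans one_lt_s2.le hw
  obtain ⟨n, hF⟩ := FTwo_eq_Fbase_translate hreal hw1
  rw [hF]
  set v := sc (((n : ℝ)) +ᵥ w) with hv
  have hvim : v.im = s2 * w.im := by rw [hv, sc_im, UpperHalfPlane.vadd_im]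
  have hv2 : 2 ≤ v.im := by rw [hvim]; nlinarith [s2_mul_s2, s2_pos]
  have h := hC v hv2
  rw [hvim] at h
  refine le_trans ?_ (le_max_left _ _)
  rw [le_div_iff₀ s2_pos]
  calc |dataTwo.Fbase v| * w.im * s2 = |dataTwo.Fbase v| * (s2 * w.im) := by ring
    _ ≤ C := h

omit hreal in
/-- `z/2 ∈ ℍ`. [folklore] -/
def halfPt (z : ℍ) : ℍ := ⟨(z : ℂ) / 2, by rw [Complex.div_ofNat_im]; exact div_pos z.im_pos two_pos⟩

omit hreal in
/-- `S • z = W₂(z/2)`. [folklore] -/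
theorem S_smul_eq_frickeTwo_halfPt (z : ℍ) : ModularGroup.S • z = frickeTwo (halfPt z) := by
  apply UpperHalfPlane.ext
  rw [UpperHalfPlane.modular_S_smul, coe_mk, coe_frickeTwo]
  change (-(z : ℂ))⁻¹ = -1 / (2 * ((z : ℂ) / 2))
  have hz : (z : ℂ) ≠ 0 := z.ne_zero
  field_simp

omit hreal in
/-- `S² = −1` in `SL₂(ℤ)`. [folklore] -/
theorem S_mul_S : ModularGroup.S * ModularGroup.S = -1 := by
  apply Subtype.ext
  rw [Matrix.SpecialLinearGroup.coe_mul, Matrix.SpecialLinearGroup.coe_neg, Matrix.SpecialLinearGroup.coe_one]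
  exact ModularGroup.S_mul_S_eq

omit hreal in
/-- `S⁻¹ = −S`. [folklore] -/
theorem S_inv_eq : ModularGroup.S⁻¹ = -ModularGroup.S := by
  apply inv_eq_of_mul_eq_one_right
  rw [mul_neg, S_mul_S, neg_neg]

omit hreal in
/-- `S⁻¹ • z = S • z`. [folklore] -/
theorem S_inv_smul (z : ℍ) : ModularGroup.S⁻¹ • z = ModularGroup.S • z := by
  rw [S_inv_eq, ModularGroup.SL_neg_smul]

omit hreal in
/-- Bottom-left entries of `σS` and `σTS`. [folklore] -/
theorem bottom_left_mul_S (σ : SL(2, ℤ)) :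
    (σ * ModularGroup.S) 1 0 = σ 1 1 ∧ (σ * ModularGroup.T * ModularGroup.S) 1 0 = σ 1 0 + σ 1 1 := by
  constructor
  · show ((σ : Matrix (Fin 2) (Fin 2) ℤ) * ModularGroup.S) 1 0 = _
    simp [Matrix.mul_apply, Fin.sum_univ_two, ModularGroup.S]
  · show ((σ : Matrix (Fin 2) (Fin 2) ℤ) * ModularGroup.T * ModularGroup.S) 1 0 = _
    simp [Matrix.mul_apply, Fin.sum_univ_two, ModularGroup.S, ModularGroup.T]

/-- **Coset reduction**: for every `σ ∈ SL₂(ℤ)` there is `w` with `Im w = Im z` and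
`FTwo(σ•z) ∈ {FTwo w, FTwo(w/2)}` (`SL₂(ℤ) = Γ₀(2){1, S⁻¹, S⁻¹T⁻¹}`, `S z = W₂(z/2)`). [folklore] -/
theorem FTwo_coset_reduction (σ : SL(2, ℤ)) (z : ℍ) :
    ∃ w : ℍ, w.im = z.im ∧ (FTwo (σ • z) = FTwo w ∨ FTwo (σ • z) = FTwo (halfPt w)) := by
  obtain ⟨hS, hTS⟩ := bottom_left_mul_S σ
  by_cases hc : (2 : ℤ) ∣ σ 1 0
  · exact ⟨z, rfl, Or.inl (FTwo_smul hreal ((mem_Gamma0_two_iff σ).mpr hc) z)⟩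
  · by_cases hd : (2 : ℤ) ∣ σ 1 1
    · -- `σ = (σS) S⁻¹`
      have hγ : σ * ModularGroup.S ∈ Gamma0 2 := by rw [mem_Gamma0_two_iff, hS]; exact hd
      refine ⟨z, rfl, Or.inr ?_⟩
      have e : σ = σ * ModularGroup.S * ModularGroup.S⁻¹ := by group
      rw [e, mul_smul, FTwo_smul hreal hγ, S_inv_smul, S_smul_eq_frickeTwo_halfPt, FTwo_frickeTwo hreal]
    · -- `σ = (σTS) S⁻¹ T⁻¹`
      have hcd : (2 : ℤ) ∣ σ 1 0 + σ 1 1 := by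
        rcases Int.emod_two_eq_zero_or_one (σ 1 0) with h0 | h0
        · exact absurd (Int.dvd_of_emod_eq_zero h0) hc
        rcases Int.emod_two_eq_zero_or_one (σ 1 1) with h1 | h1
        · exact absurd (Int.dvd_of_emod_eq_zero h1) hd
        exact Int.dvd_of_emod_eq_zero (by omega)
      have hγ : σ * ModularGroup.T * ModularGroup.S ∈ Gamma0 2 := by rw [mem_Gamma0_two_iff, hTS]; exact hcd
      refine ⟨ModularGroup.T⁻¹ • z, ?_, Or.inr ?_⟩
      · have := UpperHalfPlane.modular_T_zpow_smul z (-1)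
        rw [zpow_neg_one] at this
        rw [this, UpperHalfPlane.vadd_im]
      have e : σ = σ * ModularGroup.T * ModularGroup.S * ModularGroup.S⁻¹ * ModularGroup.T⁻¹ := by group
      rw [e, mul_smul, mul_smul, FTwo_smul hreal hγ, S_inv_smul, S_smul_eq_frickeTwo_halfPt, FTwo_frickeTwo hreal]

/-- **`FTwo` has properties (a), (c) and `Γ₀(2)`-invariance:
`IsResolventGreenLike 2 2 cmLevelTwo FTwo`.** [cite: GrossZagier1986, §II.2] -/
theorem isResolventGreenLike_FTwo : IsResolventGreenLike 2 2 cmLevelTwo FTwo where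
  smul_eq γ hγ z := FTwo_smul hreal hγ z
  contDiffAt z hz := (contDiffAt_laplacian_FTwo hreal (fun h => hz ((mem_orbit_iff_mem_cornerOrb z).mpr h))).1
  laplacian_eq z hz := by
    have := (contDiffAt_laplacian_FTwo hreal (fun h => hz ((mem_orbit_iff_mem_cornerOrb z).mpr h))).2
    simpa using this
  cusp_bound σ := by
    obtain ⟨C, hC0, hC⟩ := exists_FTwo_cusp_bound hreal
    refine ⟨2 * C, 2 * s2, fun z hz => ?_⟩
    simp only [show (2 - 1 : ℕ) = 1 from rfl, pow_one]
    obtain ⟨w, hwim, h | h⟩ := FTwo_coset_reduction hreal σ z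
    · rw [h, ← hwim]
      have := hC w (by rw [hwim]; linarith [s2_pos])
      linarith
    · rw [h]
      have him : (halfPt w).im = z.im / 2 := by
        rw [← UpperHalfPlane.coe_im]; simp [halfPt, Complex.div_ofNat_im, hwim]
      have := hC (halfPt w) (by rw [him]; linarith)
      rw [him] at this
      linarith

end Cusp

/-! ## 6. The local expansion of `g₂` at the corner -/

section Singularity

open Literature.Probability.RandomPlanarGeometry.KlebanZagier (lamC hasDerivAt_lamC hasDerivAt_theta3
  theta3_ne_zero' theta4_ne_zero')
open Literature.NumberTheory.EllipticCurves.JacobiThetaNull (theta2 theta3 theta4)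
open Literature.NumberTheory.EllipticCurves.ModularForms (analyticAt_comp_ofComplex)

/-- The corner as a complex number, `c₂' = (−1 + i)/2`. [folklore] -/
def c₂' : ℂ := ((cmLevelTwo : ℍ) : ℂ)

/-- `Im c₂' = 1/2`. [folklore] -/
theorem c₂'_im : c₂'.im = 1 / 2 := by rw [c₂', UpperHalfPlane.coe_im, cmLevelTwo_im]

/-- `Re c₂' = −1/2`. [folklore] -/
theorem c₂'_re : c₂'.re = -1 / 2 := by rw [c₂', UpperHalfPlane.coe_re, cmLevelTwo_re]

/-- `c₂' = ⟨−1/2, 1/2⟩`. [folklore] -/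
theorem c₂'_eq : c₂' = ⟨-1 / 2, 1 / 2⟩ := rfl

/-- `ofComplex c₂' = cmLevelTwo`. [folklore] -/
theorem ofComplex_c₂' : ofComplex c₂' = cmLevelTwo := by rw [c₂']; exact ofComplex_apply cmLevelTwo

/-- The scaled corner `p₂ = √2 c₂'`, of height `a = √2/2`. [folklore] -/
def p₂ : ℂ := (s2 : ℂ) * c₂'

/-- `Im p₂ = √2/2 = a`. [folklore] -/
theorem p₂_im : p₂.im = dataTwo.a := by
  rw [p₂, Complex.mul_im, Complex.ofReal_re, Complex.ofReal_im, c₂'_im, c₂'_re, dataTwo_a]; ring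

/-- `p₂ = sc cmLevelTwo`. [folklore] -/
theorem p₂_eq_sc : p₂ = sc cmLevelTwo := rfl

/-- `c₂ = −1/(1 + i)`. [folklore] -/
theorem cmLevelTwo_eq_neg_inv : cmLevelTwo =
    UpperHalfPlane.mk (-((((1 : ℝ) +ᵥ UpperHalfPlane.I : ℍ)) : ℂ))⁻¹
      (((1 : ℝ) +ᵥ UpperHalfPlane.I : ℍ)).im_inv_neg_coe_pos := by
  apply UpperHalfPlane.ext
  show (⟨-1 / 2, 1 / 2⟩ : ℂ) = (-((((1 : ℝ) +ᵥ UpperHalfPlane.I : ℍ)) : ℂ))⁻¹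
  rw [UpperHalfPlane.coe_vadd, UpperHalfPlane.coe_I]
  push_cast
  rw [eq_comm]
  apply inv_eq_of_mul_eq_one_right
  apply Complex.ext <;> simp <;> norm_num

/-- **`λ(c₂) = 2`** (`λ(i) = 1/2`, `λ(τ+1) = λ/(λ−1)`, `λ(−1/τ) = 1 − λ`). [folklore] -/
theorem modularLambda_cmLevelTwo : modularLambda cmLevelTwo = 2 := by
  rw [cmLevelTwo_eq_neg_inv, modularLambda_neg_inv, modularLambda_vadd_one', modularLambda_I]
  norm_num

/-- `𝓔(c₂) = 0`. [folklore] -/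
theorem eisTwo_cmLevelTwo : eisTwo cmLevelTwo = 0 := (eisTwo_eq_zero_iff _).mpr modularLambda_cmLevelTwo

/-- At `c₂`: `V = 2U` and `W = −U`. [folklore] -/
theorem thetaVW_cmLevelTwo : thetaV cmLevelTwo = 2 * thetaU cmLevelTwo ∧ thetaW cmLevelTwo = -thetaU cmLevelTwo := by
  have hU := thetaU_ne_zero cmLevelTwo
  have hl := modularLambda_cmLevelTwo
  rw [modularLambda, div_eq_iff hU] at hl
  refine ⟨hl, ?_⟩
  have := thetaU_apply_eq cmLevelTwo
  linear_combination -this - hl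

/-- `𝓔 ∘ ofComplex = θ₃⁴(2 − λ)/2` on the upper half-plane (as functions on `ℂ`). [folklore] -/
theorem eisTwo_ofComplex_eq {τ : ℂ} (hτ : 0 < τ.im) :
    (eisTwo ∘ ofComplex) τ = theta3 τ ^ 4 * (2 - lamC τ) / 2 := by
  rw [Function.comp_apply, eisTwo_eq, thetaU_apply, modularLambda, thetaV_apply, thetaU_apply,
    ofComplex_apply_of_im_pos hτ]
  rfl

/-- **`(𝓔 ∘ ofComplex)'(c₂') = −πi θ₃(c₂')⁴ θ₄(c₂')⁴`** (from `λ' = πiλθ₄⁴`, `λ(c₂') = 2`). [folklore] -/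
theorem hasDerivAt_eisTwo_c₂' :
    HasDerivAt (eisTwo ∘ ofComplex) (-(π * Complex.I) * theta3 c₂' ^ 4 * theta4 c₂' ^ 4) c₂' := by
  have hc : 0 < c₂'.im := by rw [c₂'_im]; norm_num
  have h3 := hasDerivAt_theta3 hc
  have hl := hasDerivAt_lamC hc
  have hlam : lamC c₂' = 2 := by
    have := modularLambda_cmLevelTwo
    rw [modularLambda, thetaV_apply, thetaU_apply] at this
    exact this
  have hprod := ((h3.pow 4).mul ((hasDerivAt_const c₂' (2 : ℂ)).sub hl)).div_const 2
  have hev : (eisTwo ∘ ofComplex) =ᶠ[𝓝 c₂'] fun τ => theta3 τ ^ 4 * (2 - lamC τ) / 2 := by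
    filter_upwards [isOpen_upperHalfPlaneSet.mem_nhds hc] with τ hτ using eisTwo_ofComplex_eq hτ
  refine (hprod.congr_of_eventuallyEq hev).congr_deriv ?_
  simp only [Pi.sub_apply, Pi.pow_apply, hlam]
  push_cast
  ring

/-- `θ₃(c₂'), θ₄(c₂') ≠ 0`. [folklore] -/
theorem theta34_c₂'_ne_zero : theta3 c₂' ≠ 0 ∧ theta4 c₂' ≠ 0 := by
  have hc : 0 < c₂'.im := by rw [c₂'_im]; norm_num
  exact ⟨theta3_ne_zero' hc, theta4_ne_zero' hc⟩

/-- The leading coefficient in the `z`-coordinate: `a₂ := Δ₂(c₂)/𝓔'(c₂)² = 1/(64π²)`; in the scaled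
coordinate `α₂ = 2a₂ = 1/(32π²)`. [folklore] -/
def αTwo : ℝ := 1 / (32 * π ^ 2)

/-- `αTwo > 0`. [folklore] -/
theorem αTwo_pos : 0 < αTwo := by rw [αTwo]; positivity

/-- **`α₂ = 2Δ₂(c₂)/𝓔'(c₂)²`.** [folklore] -/
theorem αTwo_eq : (αTwo : ℂ) = 2 * deltaTwo cmLevelTwo / (-(π * Complex.I) * theta3 c₂' ^ 4 * theta4 c₂' ^ 4) ^ 2 := by
  obtain ⟨hV, hW⟩ := thetaVW_cmLevelTwo
  obtain ⟨h3, h4⟩ := theta34_c₂'_ne_zero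
  have hU : thetaU cmLevelTwo = theta3 c₂' ^ 4 := rfl
  have hW' : thetaW cmLevelTwo = theta4 c₂' ^ 4 := rfl
  rw [deltaTwo, hV, hW] at *
  rw [hU] at hW' ⊢
  have hπ : (π : ℂ) ≠ 0 := by exact_mod_cast Real.pi_ne_zero
  rw [αTwo]
  have h4' : theta4 c₂' ^ 4 = -theta3 c₂' ^ 4 := hW'.symm
  rw [h4']
  push_cast
  field_simp
  ring_nf
  rw [Complex.I_sq]; ring

/-- **Local structure of `g₂` at `p₂`**: `g₂(ζ) = α₂/(ζ−p₂)² + b/(ζ−p₂) + h(ζ)` near `p₂` in `ℍ`, with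
`h` continuous at `p₂`. [folklore] -/
theorem gC_local_expansion : ∃ b : ℂ, ∃ h : ℂ → ℂ, ContinuousAt h p₂ ∧
    ∀ᶠ ζ in 𝓝 p₂, ζ ≠ p₂ → 0 < ζ.im →
      dataTwo.gC ζ = (αTwo : ℂ) / (ζ - p₂) ^ 2 + b / (ζ - p₂) + h ζ := by
  have hs := s2C_ne_zero
  have hc : 0 < c₂'.im := by rw [c₂'_im]; norm_num
  have hp2 : p₂ / s2 = c₂' := by rw [p₂]; field_simp
  -- `E(v) = 𝓔(v/√2)`, `Dl(v) = Δ₂(v/√2)`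
  set E : ℂ → ℂ := fun v => (eisTwo ∘ ofComplex) (v / s2) with hE
  set Dl : ℂ → ℂ := fun v => (deltaTwo ∘ ofComplex) (v / s2) with hDl
  have hlin : AnalyticAt ℂ (fun v : ℂ => v / s2) p₂ := (analyticAt_id.div analyticAt_const hs)
  have hEan : AnalyticAt ℂ E p₂ := by
    have h1 : AnalyticAt ℂ (eisTwo ∘ ofComplex) (p₂ / s2) := by
      rw [hp2, c₂']; exact analyticAt_comp_ofComplex mdifferentiable_eisTwo cmLevelTwo
    exact h1.comp_of_eq hlin rfl
  have hDan : AnalyticAt ℂ Dl p₂ := by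
    have h1 : AnalyticAt ℂ (deltaTwo ∘ ofComplex) (p₂ / s2) := by
      rw [hp2, c₂']; exact analyticAt_comp_ofComplex mdifferentiable_deltaTwo cmLevelTwo
    exact h1.comp_of_eq hlin rfl
  have hE0 : E p₂ = 0 := by
    simp only [hE]; rw [hp2, Function.comp_apply, ofComplex_c₂', eisTwo_cmLevelTwo]
  set e' : ℂ := -(π * Complex.I) * theta3 c₂' ^ 4 * theta4 c₂' ^ 4 with he'
  have hEd : HasDerivAt E (e' / s2) p₂ := by
    have h1 : HasDerivAt (eisTwo ∘ ofComplex) e' (p₂ / s2) := by rw [hp2]; exact hasDerivAt_eisTwo_c₂'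
    have h2 : HasDerivAt (fun v : ℂ => v / s2) (1 / s2) p₂ := by
      simpa using (hasDerivAt_id p₂).div_const (s2 : ℂ)
    have := h1.comp p₂ h2
    refine (this.congr_of_eventuallyEq (Eventually.of_forall fun v => rfl)).congr_deriv ?_
    field_simp
  have he'0 : e' ≠ 0 := by
    obtain ⟨h3, h4⟩ := theta34_c₂'_ne_zero
    have hπ : (π : ℂ) ≠ 0 := by exact_mod_cast Real.pi_ne_zero
    simp [he', h3, h4, hπ, Complex.I_ne_zero]
  set g : ℂ → ℂ := dslope E p₂ with hg
  have hgan : AnalyticAt ℂ g p₂ := GreenRho.analyticAt_dslope hEan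
  have hg0 : g p₂ = e' / s2 := by rw [hg, dslope_same, hEd.deriv]
  have hgne : g p₂ ≠ 0 := by rw [hg0]; exact div_ne_zero he'0 hs
  have hEfac : ∀ ζ, E ζ = (ζ - p₂) * g ζ := fun ζ => by
    have := sub_smul_dslope E p₂ ζ
    rw [smul_eq_mul, hE0, sub_zero] at this
    exact this.symm
  set φ : ℂ → ℂ := fun ζ => Dl ζ / g ζ ^ 2 with hφ
  have hφan : AnalyticAt ℂ φ p₂ := hDan.div (hgan.pow 2) (pow_ne_zero 2 hgne)
  have hφ0 : φ p₂ = αTwo := by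
    simp only [hφ]
    rw [hg0, αTwo_eq, hDl]
    simp only [Function.comp_apply]
    rw [hp2, ofComplex_c₂', ← he']
    have h2 : (s2 : ℂ) ^ 2 = 2 := by exact_mod_cast s2_sq
    field_simp
    rw [h2]
  set ψ₁ : ℂ → ℂ := dslope φ p₂ with hψ₁
  have hψ₁an : AnalyticAt ℂ ψ₁ p₂ := GreenRho.analyticAt_dslope hφan
  set ψ₂ : ℂ → ℂ := dslope ψ₁ p₂ with hψ₂
  have hψ₂an : AnalyticAt ℂ ψ₂ p₂ := GreenRho.analyticAt_dslope hψ₁an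
  refine ⟨ψ₁ p₂, ψ₂, hψ₂an.continuousAt, ?_⟩
  have hgnz : ∀ᶠ ζ in 𝓝 p₂, g ζ ≠ 0 := hgan.continuousAt.eventually_ne hgne
  filter_upwards [hgnz] with ζ hgζ hne hpos
  have h1 : φ ζ = αTwo + (ζ - p₂) * ψ₁ ζ := by
    have := sub_smul_dslope φ p₂ ζ
    rw [smul_eq_mul, hφ0] at this
    linear_combination -this
  have h2 : ψ₁ ζ = ψ₁ p₂ + (ζ - p₂) * ψ₂ ζ := by
    have := sub_smul_dslope ψ₁ p₂ ζ
    rw [smul_eq_mul] at this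
    linear_combination -this
  have hsub : ζ - p₂ ≠ 0 := sub_ne_zero.mpr hne
  have hgC : dataTwo.gC ζ = φ ζ / (ζ - p₂) ^ 2 := by
    rw [HeckeFormData.gC, dataTwo_g, gTwo, scaleDown_ofComplex hpos, fTwo]
    have e4 : eisTwo (ofComplex (ζ / s2)) = E ζ := rfl
    have eD : deltaTwo (ofComplex (ζ / s2)) = Dl ζ := rfl
    rw [e4, eD, hEfac ζ, hφ]
    field_simp
  rw [hgC, h1, h2]
  field_simp
  ring

/-- **`Fbase` near `p₂`**: `Fbase(u) = −2α₂ log‖u − p₂‖ + O(1)` on `Im u > a`. [folklore] -/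
theorem Fbase_log_bound_two : ∃ K ε : ℝ, 0 < ε ∧ ∀ u : ℂ, ‖u - p₂‖ < ε → dataTwo.a < u.im →
    |dataTwo.Fbase u + 2 * αTwo * Real.log ‖u - p₂‖| ≤ K := by
  obtain ⟨b, h, hcont, hexp⟩ := gC_local_expansion
  exact dataTwo.Fbase_log_bound p₂_im hcont hexp

end Singularity

/-! ## 8. `#Stab_{Γ₀(2)}(c₂) = 4` -/

section Stabilizer

/-- `c₂'² = −i/2`. [folklore] -/
theorem c₂'_sq : c₂' * c₂' = -(Complex.I / 2) := by
  rw [c₂'_eq]; apply Complex.ext <;> simp [Complex.mul_re, Complex.mul_im] <;> norm_num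

/-- **Fixed-point equation at `c₂`**: `g • c₂ = c₂` iff `a = d − c` and `2b = −c`. [folklore] -/
theorem smul_cmLevelTwo_eq_iff (g : SL(2, ℤ)) :
    g • cmLevelTwo = cmLevelTwo ↔ g 0 0 = g 1 1 - g 1 0 ∧ 2 * g 0 1 = -g 1 0 := by
  have hρ : ((cmLevelTwo : ℍ) : ℂ) = c₂' := rfl
  have hden : ((g 1 0 : ℤ) : ℂ) * c₂' + ((g 1 1 : ℤ) : ℂ) ≠ 0 := denom_int_ne_zero g cmLevelTwo
  have e2 : 2 * c₂' = -1 + Complex.I := by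
    rw [c₂'_eq]; apply Complex.ext <;> norm_num
  constructor
  · intro h
    have hc : ((g • cmLevelTwo : ℍ) : ℂ) = c₂' := by rw [h, hρ]
    rw [coe_smul_eq, hρ, div_eq_iff hden] at hc
    have key : (((g 0 0 : ℤ) : ℂ) - (g 1 1 : ℤ)) * (-1 + Complex.I) + 2 * ((g 0 1 : ℤ) : ℂ) +
        (g 1 0 : ℤ) * Complex.I = 0 := by
      linear_combination 2 * hc + 2 * ((g 1 0 : ℤ) : ℂ) * c₂'_sq - (((g 0 0 : ℤ) : ℂ) - (g 1 1 : ℤ)) * e2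
    have him := congrArg Complex.im key
    have hre := congrArg Complex.re key
    simp only [Complex.add_im, Complex.add_re, Complex.mul_im, Complex.mul_re, Complex.sub_im,
      Complex.sub_re, Complex.intCast_re, Complex.intCast_im, Complex.neg_re, Complex.neg_im,
      Complex.one_re, Complex.one_im, Complex.I_re, Complex.I_im, Complex.re_ofNat, Complex.im_ofNat,
      Complex.zero_re, Complex.zero_im, zero_mul, mul_zero, sub_zero, add_zero, mul_one, zero_add,
      neg_zero] at him hre
    constructor
    · have : ((g 0 0 : ℤ) : ℝ) = (g 1 1 : ℤ) - (g 1 0 : ℤ) := by linarith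
      exact_mod_cast this
    · have : 2 * ((g 0 1 : ℤ) : ℝ) = -(g 1 0 : ℤ) := by linarith
      exact_mod_cast this
  · rintro ⟨ha, hb⟩
    apply UpperHalfPlane.ext
    rw [coe_smul_eq, hρ, ha, div_eq_iff hden]
    push_cast
    have hb' : ((g 0 1 : ℤ) : ℂ) = -(g 1 0 : ℤ) / 2 := by
      have : (2 : ℂ) * (g 0 1 : ℤ) = -(g 1 0 : ℤ) := by exact_mod_cast hb
      linear_combination this / 2
    rw [hb']
    linear_combination (-((g 1 0 : ℤ) : ℂ)) * c₂'_sq - (((g 1 0 : ℤ) : ℂ) / 2) * e2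

/-- The solutions `(k, d)` of `(d − k)² + k² = 1`. [folklore] -/
def pairsTwo : Finset (ℤ × ℤ) := {(0, 1), (0, -1), (1, 1), (-1, -1)}

/-- Membership in `pairsTwo`. [folklore] -/
theorem mem_pairsTwo_iff (p : ℤ × ℤ) : p ∈ pairsTwo ↔ (p.2 - p.1) ^ 2 + p.1 ^ 2 = 1 := by
  obtain ⟨k, d⟩ := p
  constructor
  · intro h
    simp only [pairsTwo, Finset.mem_insert, Finset.mem_singleton, Prod.mk.injEq] at h
    rcases h with ⟨rfl, rfl⟩ | ⟨rfl, rfl⟩ | ⟨rfl, rfl⟩ | ⟨rfl, rfl⟩ <;> norm_num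
  · intro h
    simp only at h
    have hk : k ^ 2 ≤ 1 := by nlinarith [sq_nonneg (d - k)]
    have hdk : (d - k) ^ 2 ≤ 1 := by nlinarith [sq_nonneg k]
    have hk1 : -1 ≤ k ∧ k ≤ 1 := by constructor <;> nlinarith
    have hd1 : -1 ≤ d - k ∧ d - k ≤ 1 := by constructor <;> nlinarith
    have hd2 : -2 ≤ d ∧ d ≤ 2 := by constructor <;> linarith [hk1.1, hk1.2, hd1.1, hd1.2]
    simp only [pairsTwo, Finset.mem_insert, Finset.mem_singleton, Prod.mk.injEq]
    obtain ⟨hk1a, hk1b⟩ := hk1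
    obtain ⟨hd2a, hd2b⟩ := hd2
    interval_cases k <;> interval_cases d <;> simp_all

/-- `#pairsTwo = 4`. [folklore] -/
theorem card_pairsTwo : pairsTwo.card = 4 := by decide

/-- The matrix `(d − 2k, −k; 2k, d)` of determinant `(d−k)² + k²`. [folklore] -/
def stabMatTwo (p : ℤ × ℤ) (hp : (p.2 - p.1) ^ 2 + p.1 ^ 2 = 1) : SL(2, ℤ) :=
  ⟨!![p.2 - 2 * p.1, -p.1; 2 * p.1, p.2], by rw [Matrix.det_fin_two_of]; nlinarith [hp]⟩

/-- `stabMatTwo p ∈ Γ₀(2)`. [folklore] -/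
theorem stabMatTwo_mem (p : ℤ × ℤ) (hp : (p.2 - p.1) ^ 2 + p.1 ^ 2 = 1) : stabMatTwo p hp ∈ Gamma0 2 := by
  rw [mem_Gamma0_two_iff]
  show (2 : ℤ) ∣ (!![p.2 - 2 * p.1, -p.1; 2 * p.1, p.2] : Matrix (Fin 2) (Fin 2) ℤ) 1 0
  simp

/-- **`#Stab_{Γ₀(2)}(c₂) = 4`.** [folklore] -/
theorem card_stabilizer_cmLevelTwo : Nat.card (MulAction.stabilizer (Gamma0 2) cmLevelTwo) = 4 := by
  let e : MulAction.stabilizer (Gamma0 2) cmLevelTwo ≃ {p : ℤ × ℤ // p ∈ pairsTwo} :=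
    { toFun := fun γ => ⟨(((γ : Gamma0 2) : SL(2, ℤ)) 1 0 / 2, ((γ : Gamma0 2) : SL(2, ℤ)) 1 1), by
        rw [mem_pairsTwo_iff]
        have hγ := γ.2
        rw [MulAction.mem_stabilizer_iff] at hγ
        have hfix : ((γ : Gamma0 2) : SL(2, ℤ)) • cmLevelTwo = cmLevelTwo := hγ
        obtain ⟨ha, hb⟩ := (smul_cmLevelTwo_eq_iff _).mp hfix
        obtain ⟨k, hk⟩ := (mem_Gamma0_two_iff _).mp (γ : Gamma0 2).2
        have hdet := det_two_entries ((γ : Gamma0 2) : SL(2, ℤ))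
        rw [ha, hk] at hdet
        simp only
        rw [hk, Int.mul_ediv_cancel_left _ two_ne_zero]
        have hb2 : ((γ : Gamma0 2) : SL(2, ℤ)) 0 1 = -k := by rw [hk] at hb; linarith
        rw [hb2] at hdet
        nlinarith [hdet]⟩
      invFun := fun p => ⟨⟨stabMatTwo p.1 ((mem_pairsTwo_iff _).mp p.2), stabMatTwo_mem _ _⟩, by
        rw [MulAction.mem_stabilizer_iff]
        have h := (smul_cmLevelTwo_eq_iff (stabMatTwo p.1 ((mem_pairsTwo_iff _).mp p.2))).mpr
          (by simp [stabMatTwo])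
        exact h⟩
      left_inv := fun γ => by
        apply Subtype.ext; apply Subtype.ext
        have hγ := γ.2
        rw [MulAction.mem_stabilizer_iff] at hγ
        have hfix : ((γ : Gamma0 2) : SL(2, ℤ)) • cmLevelTwo = cmLevelTwo := hγ
        obtain ⟨ha, hb⟩ := (smul_cmLevelTwo_eq_iff _).mp hfix
        obtain ⟨k, hk⟩ := (mem_Gamma0_two_iff _).mp (γ : Gamma0 2).2
        have hb2 : ((γ : Gamma0 2) : SL(2, ℤ)) 0 1 = -k := by rw [hk] at hb; linarith
        have hk' : ((γ : Gamma0 2) : SL(2, ℤ)) 1 0 / 2 = k := by rw [hk, Int.mul_ediv_cancel_left _ two_ne_zero]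
        ext i j
        fin_cases i <;> fin_cases j <;> simp [stabMatTwo, ha, hb2, hk]
      right_inv := fun p => by
        apply Subtype.ext
        simp [stabMatTwo] }
  rw [Nat.card_congr e, Nat.card_eq_fintype_card, Fintype.card_coe, card_pairsTwo]

end Stabilizer

/-! ## 7. Representatives near the corner and the logarithmic singularity of `FTwo` -/

section NearCorner

/-- `‖c₂'‖² = 1/2` and `‖c₂' + 1‖² = 1/2`. [folklore] -/
theorem normSq_c₂' : Complex.normSq c₂' = 1 / 2 ∧ Complex.normSq (c₂' + 1) = 1 / 2 := by
  rw [c₂'_eq]; constructor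
  · rw [Complex.normSq_mk]; norm_num
  · rw [show (⟨-1 / 2, 1 / 2⟩ : ℂ) + 1 = ⟨1 / 2, 1 / 2⟩ by apply Complex.ext <;> norm_num,
      Complex.normSq_mk]; norm_num

/-- `2c₂' + 1 = i`, `c₂'/(2c₂'+1) = c₂' + 1`, `−1/(2c₂') = c₂' + 1`, `−1/(2(c₂'+1)) = c₂'`. [folklore] -/
theorem c₂'_identities : 2 * c₂' + 1 = Complex.I ∧ c₂' / (2 * c₂' + 1) = c₂' + 1 ∧
    -1 / (2 * c₂') = c₂' + 1 ∧ -1 / (2 * (c₂' + 1)) = c₂' := by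
  have e2 : 2 * c₂' + 1 = Complex.I := by rw [c₂'_eq]; apply Complex.ext <;> norm_num
  have hc0 : c₂' ≠ 0 := by
    intro h; have := congrArg Complex.im h; rw [c₂'_im] at this; norm_num at this
  have hc1 : c₂' + 1 ≠ 0 := by
    intro h; have := congrArg Complex.im h; rw [Complex.add_im, c₂'_im] at this; norm_num at this
  have hsq := c₂'_sq
  refine ⟨e2, ?_, ?_, ?_⟩
  · rw [e2, div_eq_iff Complex.I_ne_zero]
    linear_combination (-2) * hsq + c₂' * e2
  · rw [div_eq_iff (mul_ne_zero two_ne_zero hc0)]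
    linear_combination (-2) * hsq - e2
  · rw [div_eq_iff (mul_ne_zero two_ne_zero hc1)]
    linear_combination (-2) * hsq - e2

set_option maxHeartbeats 1600000 in
/-- **The representatives near the corner.** If `‖z − c₂'‖ < 1/20`, `u ∈ 𝒟₂ ∩ Γ₀(2)⁺z` and
`Im u > 1/2`, then `u − n ∈ {z, z/(2z+1) − 1, W₂z − 1, W₂(z+1)}` for some `n ∈ ℤ`. [folklore] -/
theorem rep_cases_near {z u : ℍ} (hδ : ‖(z : ℂ) - c₂'‖ < 1 / 20) (huz : u ∈ orbTwo z)
    (him : 1 / 2 < u.im) :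
    ∃ v : ℂ, (v = (z : ℂ) ∨ v = (z : ℂ) / (2 * z + 1) - 1 ∨ v = -1 / (2 * (z : ℂ)) - 1 ∨
      v = -1 / (2 * ((z : ℂ) + 1))) ∧ ∃ n : ℤ, (u : ℂ) = v + n := by
  -- position of `z`
  have hzim : |z.im - 1 / 2| < 1 / 20 := by
    have : ((z : ℂ) - c₂').im = z.im - 1 / 2 := by simp [c₂'_im]
    rw [← this]; exact (Complex.abs_im_le_norm _).trans_lt hδ
  have hzre : |z.re + 1 / 2| < 1 / 20 := by
    have : ((z : ℂ) - c₂').re = z.re + 1 / 2 := by simp [c₂'_re]; ring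
    rw [← this]; exact (Complex.abs_re_le_norm _).trans_lt hδ
  obtain ⟨hzim1, hzim2⟩ := abs_lt.mp hzim
  obtain ⟨hzre1, hzre2⟩ := abs_lt.mp hzre
  have hn2 : 2 / 5 < Complex.normSq (z : ℂ) := by
    rw [Complex.normSq_apply, UpperHalfPlane.coe_re, UpperHalfPlane.coe_im]; nlinarith
  have hn3 : 2 / 5 < Complex.normSq ((z : ℂ) + 1) := by
    rw [Complex.normSq_apply]; simp only [Complex.add_re, Complex.one_re, Complex.add_im, Complex.one_im,
      UpperHalfPlane.coe_re, UpperHalfPlane.coe_im, add_zero]; nlinarith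
  have hz0 : (z : ℂ) ≠ 0 := z.ne_zero
  have hz1 : (2 : ℂ) * z + 1 ≠ 0 := by
    intro h; have := congrArg Complex.im h; simp at this; linarith [z.im_pos]
  have hz2 : (z : ℂ) + 1 ≠ 0 := by
    intro h; have := congrArg Complex.im h; simp at this; linarith [z.im_pos]
  have hz1a : (1 : ℂ) + z * 2 ≠ 0 := by rw [show (1 : ℂ) + z * 2 = 2 * z + 1 by ring]; exact hz1
  have hz1b : (-1 : ℂ) - z * 2 ≠ 0 := by rw [show (-1 : ℂ) - z * 2 = -(2 * z + 1) by ring]; exact neg_ne_zero.mpr hz1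
  have hz2a : (1 : ℂ) + z ≠ 0 := by rw [add_comm]; exact hz2
  have hz2b : (-1 : ℂ) - z ≠ 0 := by rw [show (-1 : ℂ) - z = -((z : ℂ) + 1) by ring]; exact neg_ne_zero.mpr hz2
  obtain ⟨γ, hγ, hcase⟩ := huz
  obtain ⟨k, hk⟩ := (mem_Gamma0_two_iff γ).mp hγ
  set a : ℤ := γ 0 0 with ha
  set b : ℤ := γ 0 1 with hb
  set d : ℤ := γ 1 1 with hd
  have hdet : a * d - b * (2 * k) = 1 := by have := det_two_entries γ; rw [hk] at this; exact this
  rcases hcase with rfl | rfl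
  · -- Case 1: `u = γ • z`
    have hcoe : ((γ • z : ℍ) : ℂ) = ((a : ℂ) * z + (b : ℂ)) / ((((2 * k : ℤ)) : ℂ) * z + (d : ℂ)) := by
      rw [coe_smul_eq, hk]
    have himu : (γ • z).im = z.im / Complex.normSq ((((2 * k : ℤ)) : ℂ) * z + (d : ℂ)) := by
      rw [im_smul_eq, hk]
    set N := Complex.normSq ((((2 * k : ℤ)) : ℂ) * z + (d : ℂ)) with hN
    have hNexp : N = (2 * (k : ℝ) * z.re + d) ^ 2 + 4 * (k : ℝ) ^ 2 * z.im ^ 2 := by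
      rw [hN, Complex.normSq_apply]
      simp only [Complex.add_re, Complex.mul_re, Complex.intCast_re, Complex.intCast_im, zero_mul,
        sub_zero, UpperHalfPlane.coe_re, Complex.add_im, Complex.mul_im, add_zero, UpperHalfPlane.coe_im]
      push_cast; ring
    have hN0 : 0 < N := by
      have hu0 := (γ • z).im_pos
      rw [himu] at hu0
      rcases div_pos_iff.mp hu0 with h | h
      · exact h.2
      · exact absurd z.im_pos (not_lt.mpr h.1.le)
    have hN1 : N < 11 / 10 := by
      rw [himu, lt_div_iff₀ hN0] at him; nlinarith
    -- integer constraints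
    have hk1 : k ^ 2 ≤ 1 := by
      have h1 : 4 * (k : ℝ) ^ 2 * z.im ^ 2 ≤ N := by rw [hNexp]; nlinarith
      have h2 : (k : ℝ) ^ 2 < 2 := by nlinarith
      have h3 : k ^ 2 < 2 := by exact_mod_cast h2
      nlinarith
    have hd_le : -2 ≤ d ∧ d ≤ 2 := by
      have h1 : (2 * (k : ℝ) * z.re + d) ^ 2 < 11 / 10 := by rw [hNexp] at hN1; nlinarith
      have hkr : (k : ℝ) ^ 2 ≤ 1 := by exact_mod_cast hk1
      have h3 : |(d : ℝ)| ≤ |2 * (k : ℝ) * z.re + d| + |2 * (k : ℝ) * z.re| := by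
        have := abs_sub (2 * (k : ℝ) * z.re + d) (2 * (k : ℝ) * z.re)
        rwa [show 2 * (k : ℝ) * z.re + d - 2 * (k : ℝ) * z.re = d by ring] at this
      have h4 : |2 * (k : ℝ) * z.re + d| < 11 / 10 :=
        abs_lt_of_sq_lt_sq (by nlinarith) (by norm_num)
      have h5 : |2 * (k : ℝ) * z.re| ≤ 11 / 10 := by
        rw [abs_mul, abs_mul]
        have hk' : |(k : ℝ)| ≤ 1 := by rw [← sq_le_one_iff_abs_le_one]; exact hkr
        have hz' : |z.re| ≤ 11 / 20 := by rw [abs_le]; constructor <;> linarith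
        calc |(2:ℝ)| * |(k : ℝ)| * |z.re| ≤ 2 * 1 * (11 / 20) := by
              rw [abs_two]; gcongr
          _ = 11 / 10 := by norm_num
      have h6 : |(d : ℝ)| < 5 / 2 := by linarith
      obtain ⟨h6a, h6b⟩ := abs_lt.mp h6
      constructor
      · have : ((-3 : ℤ) : ℝ) < d := by push_cast; linarith
        have : (-3 : ℤ) < d := by exact_mod_cast this
        omega
      · have : (d : ℝ) < ((3 : ℤ) : ℝ) := by push_cast; linarith
        have : d < 3 := by exact_mod_cast this
        omega
    have hk_le : -1 ≤ k ∧ k ≤ 1 := by constructor <;> nlinarith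
    have hNr : ((2 * (k : ℝ) * z.re + d) ^ 2 + 4 * (k : ℝ) ^ 2 * z.im ^ 2) < 11 / 10 := by rw [← hNexp]; exact hN1
    have hNpos : 0 < ((2 * (k : ℝ) * z.re + d) ^ 2 + 4 * (k : ℝ) ^ 2 * z.im ^ 2) := by rw [← hNexp]; exact hN0
    have hzn : 2 / 5 < z.re ^ 2 + z.im ^ 2 := by
      rw [Complex.normSq_apply, UpperHalfPlane.coe_re, UpperHalfPlane.coe_im] at hn2; nlinarith
    obtain ⟨hk_a, hk_b⟩ := hk_le
    obtain ⟨hd_a, hd_b⟩ := hd_le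
    -- the four admissible rows
    have hrows : (k = 0 ∧ (d = 1 ∨ d = -1)) ∨ (k = 1 ∧ d = 1) ∨ (k = -1 ∧ d = -1) := by
      interval_cases k <;> interval_cases d <;> push_cast at hNr hNpos <;> norm_num <;>
        nlinarith [hNr, hNpos, hzre1, hzre2, hzim1, hzim2, hzn, sq_nonneg z.re, sq_nonneg z.im]
    rcases hrows with ⟨hk0, hd1⟩ | ⟨hk0, hd0⟩ | ⟨hk0, hd0⟩
    · -- `k = 0`: translation
      refine ⟨(z : ℂ), Or.inl rfl, ?_⟩
      rw [hk0] at hcoe hdet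
      rcases hd1 with hd0 | hd0 <;> rw [hd0] at hcoe hdet
      · have ha1 : a = 1 := by linarith
        refine ⟨b, ?_⟩
        rw [hcoe, ha1]; push_cast; ring
      · have ha1 : a = -1 := by linarith
        refine ⟨-b, ?_⟩
        rw [hcoe, ha1]; push_cast; ring
    · -- `(c, d) = (2, 1)`: `u = z/(2z+1) + b`
      rw [hk0, hd0] at hcoe hdet
      have ha1 : a = 1 + 2 * b := by linarith
      refine ⟨(z : ℂ) / (2 * z + 1) - 1, Or.inr (Or.inl rfl), b + 1, ?_⟩
      rw [hcoe, ha1]; push_cast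
      field_simp
      ring
    · -- `(c, d) = (−2, −1)`: `u = z/(2z+1) − b`
      rw [hk0, hd0] at hcoe hdet
      have ha1 : a = 2 * b - 1 := by linarith
      refine ⟨(z : ℂ) / (2 * z + 1) - 1, Or.inr (Or.inl rfl), 1 - b, ?_⟩
      have e : ((γ • z : ℍ) : ℂ) = ((((2 * b - 1 : ℤ)) : ℂ) * z + b) / (-(2 * (z : ℂ) + 1)) := by
        rw [hcoe, ha1]; congr 1; push_cast; ring
      rw [e, div_neg]
      push_cast
      field_simp
      ring
  · -- Case 2: `u = γ • W₂ z`
    set w : ℍ := frickeTwo z with hw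
    have hwcoe : ((w : ℍ) : ℂ) = -1 / (2 * (z : ℂ)) := by rw [hw, coe_frickeTwo]
    have hcoe : ((γ • w : ℍ) : ℂ) = ((a : ℂ) * w + (b : ℂ)) / ((((2 * k : ℤ)) : ℂ) * w + (d : ℂ)) := by
      rw [coe_smul_eq, hk]
    have himu : (γ • w).im = 2 * z.im / Complex.normSq (2 * ((d : ℤ) : ℂ) * z - (((2 * k : ℤ)) : ℂ)) := by
      rw [hw, im_smul_frickeTwo_eq, hk]
    set M := Complex.normSq (2 * ((d : ℤ) : ℂ) * z - (((2 * k : ℤ)) : ℂ)) with hM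
    have hMexp : M = 4 * (((d : ℝ) * z.re - k) ^ 2 + (d : ℝ) ^ 2 * z.im ^ 2) := by
      rw [hM, Complex.normSq_apply]
      simp only [Complex.sub_re, Complex.mul_re, Complex.intCast_re, Complex.intCast_im, Complex.re_ofNat,
        Complex.im_ofNat, zero_mul, sub_zero, UpperHalfPlane.coe_re, Complex.sub_im, Complex.mul_im,
        add_zero, UpperHalfPlane.coe_im, mul_zero]
      push_cast; ring
    have hM0 : 0 < M := by
      have hu0 := (γ • w).im_pos
      rw [himu] at hu0
      rcases div_pos_iff.mp hu0 with h | h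
      · exact h.2
      · exfalso; linarith [h.1, z.im_pos]
    have hM1 : M < 22 / 10 := by
      rw [himu, lt_div_iff₀ hM0] at him; nlinarith
    have hMr : ((d : ℝ) * z.re - k) ^ 2 + (d : ℝ) ^ 2 * z.im ^ 2 < 11 / 20 := by rw [hMexp] at hM1; nlinarith
    have hd_le : -1 ≤ d ∧ d ≤ 1 := by
      have h1 : (d : ℝ) ^ 2 * z.im ^ 2 < 11 / 20 := by nlinarith [sq_nonneg ((d : ℝ) * z.re - k)]
      have h2 : (d : ℝ) ^ 2 < 2 ^ 2 := by nlinarith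
      have h3 : |(d : ℝ)| < 2 := abs_lt_of_sq_lt_sq h2 (by norm_num)
      obtain ⟨h3a, h3b⟩ := abs_lt.mp h3
      constructor
      · have : ((-2 : ℤ) : ℝ) < d := by push_cast; linarith
        have : (-2 : ℤ) < d := by exact_mod_cast this
        omega
      · have : (d : ℝ) < ((2 : ℤ) : ℝ) := by push_cast; linarith
        have : d < 2 := by exact_mod_cast this
        omega
    have hk_le : -1 ≤ k ∧ k ≤ 1 := by
      have hdr : (d : ℝ) ^ 2 ≤ 1 := by
        have : d ^ 2 ≤ 1 := by nlinarith [hd_le.1, hd_le.2]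
        exact_mod_cast this
      have h1 : ((d : ℝ) * z.re - k) ^ 2 < 11 / 20 := by nlinarith [sq_nonneg (d : ℝ), sq_nonneg z.im]
      have h4 : |(d : ℝ) * z.re - k| < 1 := abs_lt_of_sq_lt_sq (by nlinarith) (by norm_num)
      have h5 : |(d : ℝ) * z.re| ≤ 11 / 20 := by
        rw [abs_mul]
        have hd' : |(d : ℝ)| ≤ 1 := by rw [← sq_le_one_iff_abs_le_one]; exact hdr
        have hz' : |z.re| ≤ 11 / 20 := by rw [abs_le]; constructor <;> linarith
        calc |(d : ℝ)| * |z.re| ≤ 1 * (11 / 20) := by gcongr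
          _ = 11 / 20 := by norm_num
      have h3 : |(k : ℝ)| ≤ |(d : ℝ) * z.re| + |(d : ℝ) * z.re - k| := by
        have := abs_sub ((d : ℝ) * z.re) ((d : ℝ) * z.re - k)
        rwa [show (d : ℝ) * z.re - ((d : ℝ) * z.re - k) = k by ring] at this
      have h6 : |(k : ℝ)| < 2 := by linarith
      obtain ⟨h6a, h6b⟩ := abs_lt.mp h6
      constructor
      · have : ((-2 : ℤ) : ℝ) < k := by push_cast; linarith
        have : (-2 : ℤ) < k := by exact_mod_cast this
        omega
      · have : (k : ℝ) < ((2 : ℤ) : ℝ) := by push_cast; linarith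
        have : k < 2 := by exact_mod_cast this
        omega
    have hMpos : 0 < ((d : ℝ) * z.re - k) ^ 2 + (d : ℝ) ^ 2 * z.im ^ 2 := by rw [hMexp] at hM0; nlinarith
    have hzn1 : 2 / 5 < (z.re + 1) ^ 2 + z.im ^ 2 := by
      rw [Complex.normSq_apply] at hn3
      simp only [Complex.add_re, Complex.one_re, Complex.add_im, Complex.one_im, UpperHalfPlane.coe_re,
        UpperHalfPlane.coe_im, add_zero] at hn3
      nlinarith
    obtain ⟨hk_a, hk_b⟩ := hk_le
    obtain ⟨hd_a, hd_b⟩ := hd_le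
    have hrows : (k = 0 ∧ (d = 1 ∨ d = -1)) ∨ (k = -1 ∧ d = 1) ∨ (k = 1 ∧ d = -1) := by
      interval_cases k <;> interval_cases d <;> push_cast at hMr hMpos <;> norm_num <;>
        nlinarith [hMr, hMpos, hzre1, hzre2, hzim1, hzim2, hzn1, sq_nonneg z.re, sq_nonneg z.im]
    rcases hrows with ⟨hk0, hd1'⟩ | ⟨hk0, hd0⟩ | ⟨hk0, hd0⟩
    · refine ⟨-1 / (2 * (z : ℂ)) - 1, Or.inr (Or.inr (Or.inl rfl)), ?_⟩
      rw [hk0] at hcoe hdet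
      rcases hd1' with hd0 | hd0 <;> rw [hd0] at hcoe hdet
      · have ha1 : a = 1 := by linarith
        refine ⟨b + 1, ?_⟩
        rw [hcoe, ha1, hwcoe]; push_cast; ring
      · have ha1 : a = -1 := by linarith
        refine ⟨1 - b, ?_⟩
        rw [hcoe, ha1, hwcoe]; push_cast
        field_simp
        ring
    · -- `(c, d) = (−2, 1)`: `u = W₂(z+1) + b`
      rw [hk0, hd0] at hcoe hdet
      have ha1 : a = 1 - 2 * b := by linarith
      refine ⟨-1 / (2 * ((z : ℂ) + 1)), Or.inr (Or.inr (Or.inr rfl)), b, ?_⟩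
      rw [hcoe, ha1, hwcoe]; push_cast
      have h1 : (2 : ℂ) * (-1) * (-1 / (2 * z)) + 1 ≠ 0 := by
        rw [show (2 : ℂ) * (-1) * (-1 / (2 * z)) + 1 = ((z : ℂ) + 1) / z by field_simp; ring]
        exact div_ne_zero hz2 hz0
      field_simp
      ring
    · -- `(c, d) = (2, −1)`: `u = W₂(z+1) − b`
      rw [hk0, hd0] at hcoe hdet
      have ha1 : a = -1 - 2 * b := by linarith
      refine ⟨-1 / (2 * ((z : ℂ) + 1)), Or.inr (Or.inr (Or.inr rfl)), -b, ?_⟩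
      have e : ((γ • w : ℍ) : ℂ) = ((((-1 - 2 * b : ℤ)) : ℂ) * (-1 / (2 * z)) + b) / (-(((z : ℂ) + 1) / z)) := by
        rw [hcoe, ha1, hwcoe]; congr 1; push_cast; field_simp; ring
      rw [e, div_neg]
      push_cast
      field_simp
      ring

/-- **Distances of the four representatives to the corner** are comparable to `‖z − c₂'‖`. [folklore] -/
theorem rep_dist_comparable {z : ℍ} (hδ : ‖(z : ℂ) - c₂'‖ < 1 / 20) {v : ℂ}
    (hv : v = (z : ℂ) ∨ v = (z : ℂ) / (2 * z + 1) - 1 ∨ v = -1 / (2 * (z : ℂ)) - 1 ∨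
      v = -1 / (2 * ((z : ℂ) + 1))) :
    ‖v - c₂'‖ ≤ 2 * ‖(z : ℂ) - c₂'‖ ∧ ‖(z : ℂ) - c₂'‖ ≤ 2 * ‖v - c₂'‖ := by
  obtain ⟨e2, hq, hw1, hw2⟩ := c₂'_identities
  obtain ⟨hn1, hn2⟩ := normSq_c₂'
  have hc0 : c₂' ≠ 0 := by
    intro h; have := congrArg Complex.im h; rw [c₂'_im] at this; norm_num at this
  have hc1 : c₂' + 1 ≠ 0 := by
    intro h; have := congrArg Complex.im h; rw [Complex.add_im, c₂'_im] at this; norm_num at this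
  have hnc : ‖c₂'‖ ^ 2 = 1 / 2 := by rw [← Complex.normSq_eq_norm_sq]; exact hn1
  have hnc1 : ‖c₂' + 1‖ ^ 2 = 1 / 2 := by rw [← Complex.normSq_eq_norm_sq]; exact hn2
  have hcn : ‖c₂'‖ < 1 := by nlinarith [norm_nonneg c₂']
  have hcn1 : ‖c₂' + 1‖ < 1 := by nlinarith [norm_nonneg (c₂' + 1)]
  have hz0 : (z : ℂ) ≠ 0 := z.ne_zero
  have hz1 : (2 : ℂ) * z + 1 ≠ 0 := by
    intro h; have := congrArg Complex.im h; simp at this; linarith [z.im_pos]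
  have hz2 : (z : ℂ) + 1 ≠ 0 := by
    intro h; have := congrArg Complex.im h; simp at this; linarith [z.im_pos]
  set δ := ‖(z : ℂ) - c₂'‖ with hδdef
  have hδ0 : 0 ≤ δ := norm_nonneg _
  -- generic comparison from `v − c₂' = (z − c₂')/D` with `1/2 ≤ ‖D‖ ≤ 2`
  have key : ∀ D : ℂ, D ≠ 0 → v - c₂' = ((z : ℂ) - c₂') / D → 1 / 2 ≤ ‖D‖ → ‖D‖ ≤ 2 →
      ‖v - c₂'‖ ≤ 2 * δ ∧ δ ≤ 2 * ‖v - c₂'‖ := by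
    intro D hD he h1 h2
    have hDpos : 0 < ‖D‖ := norm_pos_iff.mpr hD
    rw [he, norm_div]
    constructor
    · rw [div_le_iff₀ hDpos]; nlinarith
    · rw [mul_div_assoc', le_div_iff₀ hDpos]; nlinarith
  rcases hv with rfl | rfl | rfl | rfl
  · constructor <;> linarith
  · -- `D = (2z+1)(2c₂'+1) = (2z+1) i`
    refine key ((2 * (z : ℂ) + 1) * Complex.I) (mul_ne_zero hz1 Complex.I_ne_zero) ?_ ?_ ?_
    · rw [show (z : ℂ) / (2 * z + 1) - 1 - c₂' = (z : ℂ) / (2 * z + 1) - c₂' / (2 * c₂' + 1) by rw [hq]; ring,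
        e2]
      have hI : Complex.I ≠ 0 := Complex.I_ne_zero
      rw [div_sub_div _ _ hz1 hI, div_eq_div_iff (mul_ne_zero hz1 hI) (mul_ne_zero hz1 hI)]
      linear_combination (-(z : ℂ)) * ((2 * (z : ℂ) + 1) * Complex.I) * e2
    · rw [norm_mul, Complex.norm_I, mul_one]
      have : ‖(2 : ℂ) * z + 1‖ ≥ ‖Complex.I‖ - ‖2 * ((z : ℂ) - c₂')‖ := by
        have h := norm_sub_norm_le Complex.I (2 * ((z : ℂ) - c₂') + Complex.I)
        rw [show Complex.I - (2 * ((z : ℂ) - c₂') + Complex.I) = -(2 * ((z : ℂ) - c₂')) by ring, norm_neg] at h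
        rw [show (2 : ℂ) * z + 1 = 2 * ((z : ℂ) - c₂') + Complex.I by rw [← e2]; ring]
        linarith
      rw [Complex.norm_I, norm_mul, Complex.norm_two] at this
      linarith
    · rw [norm_mul, Complex.norm_I, mul_one, show (2 : ℂ) * z + 1 = 2 * ((z : ℂ) - c₂') + Complex.I by rw [← e2]; ring]
      calc ‖2 * ((z : ℂ) - c₂') + Complex.I‖ ≤ ‖2 * ((z : ℂ) - c₂')‖ + ‖Complex.I‖ := norm_add_le _ _
        _ = 2 * δ + 1 := by rw [norm_mul, Complex.norm_two, Complex.norm_I]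
        _ ≤ 2 := by linarith
  · -- `D = 2 z c₂'`
    refine key (2 * (z : ℂ) * c₂') (mul_ne_zero (mul_ne_zero two_ne_zero hz0) hc0) ?_ ?_ ?_
    · rw [show -1 / (2 * (z : ℂ)) - 1 - c₂' = -1 / (2 * (z : ℂ)) - (-1 / (2 * c₂')) by rw [hw1]; ring]
      field_simp
      ring
    · rw [norm_mul, norm_mul, Complex.norm_two]
      have hz' : ‖c₂'‖ - δ ≤ ‖(z : ℂ)‖ := by
        have := norm_sub_norm_le c₂' (z : ℂ); rw [norm_sub_rev] at this; linarith
      have h1 := mul_le_mul_of_nonneg_right hz' (norm_nonneg c₂')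
      have h2 := mul_le_mul_of_nonneg_left hcn.le hδ0
      nlinarith [norm_nonneg (z : ℂ)]
    · rw [norm_mul, norm_mul, Complex.norm_two]
      have hz' : ‖(z : ℂ)‖ ≤ ‖c₂'‖ + δ := by
        have := norm_le_norm_add_norm_sub' (z : ℂ) c₂'; linarith
      nlinarith [norm_nonneg (z : ℂ)]
  · -- `D = 2 (z+1)(c₂'+1)`
    refine key (2 * ((z : ℂ) + 1) * (c₂' + 1)) (mul_ne_zero (mul_ne_zero two_ne_zero hz2) hc1) ?_ ?_ ?_
    · rw [show -1 / (2 * ((z : ℂ) + 1)) - c₂' = -1 / (2 * ((z : ℂ) + 1)) - (-1 / (2 * (c₂' + 1))) by rw [hw2]]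
      field_simp
      ring
    · rw [norm_mul, norm_mul, Complex.norm_two]
      have hz' : ‖c₂' + 1‖ - δ ≤ ‖(z : ℂ) + 1‖ := by
        have := norm_sub_norm_le (c₂' + 1) ((z : ℂ) + 1)
        rw [show c₂' + 1 - ((z : ℂ) + 1) = -((z : ℂ) - c₂') by ring, norm_neg] at this; linarith
      have h1 := mul_le_mul_of_nonneg_right hz' (norm_nonneg (c₂' + 1))
      have h2 := mul_le_mul_of_nonneg_left hcn1.le hδ0
      nlinarith [norm_nonneg ((z : ℂ) + 1)]
    · rw [norm_mul, norm_mul, Complex.norm_two]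
      have hz' : ‖(z : ℂ) + 1‖ ≤ ‖c₂' + 1‖ + δ := by
        have := norm_add_le (c₂' + 1) ((z : ℂ) - c₂')
        rw [show c₂' + 1 + ((z : ℂ) - c₂') = (z : ℂ) + 1 by ring] at this; linarith
      nlinarith [norm_nonneg ((z : ℂ) + 1)]

/-- **The logarithmic singularity of `FTwo` at `c₂`**:
`FTwo(z) = −2α₂ log‖z − c₂'‖ + O(1)` for `z` off the orbit near `c₂`. [folklore] -/
theorem FTwo_log_bound : ∃ C ε : ℝ, 0 < ε ∧ ∀ z : ℍ, z ∉ MulAction.orbit (Gamma0 2) cmLevelTwo →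
    ‖(z : ℂ) - c₂'‖ < ε → |FTwo z + 2 * αTwo * Real.log ‖(z : ℂ) - c₂'‖| ≤ C := by
  obtain ⟨K, ε₁, hε₁, hK⟩ := Fbase_log_bound_two
  refine ⟨K + 2 * αTwo * (2 * Real.log 2), min (1 / 20) (ε₁ / 4), lt_min (by norm_num) (by linarith),
    fun z hz hd => ?_⟩
  have hd1 : ‖(z : ℂ) - c₂'‖ < 1 / 20 := lt_of_lt_of_le hd (min_le_left _ _)
  have hd2 : ‖(z : ℂ) - c₂'‖ < ε₁ / 4 := lt_of_lt_of_le hd (min_le_right _ _)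
  have hzno : z ∉ cornerOrb := fun h => hz ((mem_orbit_iff_mem_cornerOrb z).mpr h)
  set u := repTwo z with hu
  have hufd : u ∈ fdTwo := repTwo_mem_fdTwo z
  have huorb : u ∈ orbTwo z := repTwo_mem_orbTwo z
  have huno : u ∉ cornerOrb := fun h => hzno ((mem_cornerOrb_iff_of_mem_orbTwo huorb).mp h)
  have huim : 1 / 2 < u.im := half_lt_im_of_mem_fdTwo hufd huno
  have hF : FTwo z = dataTwo.Fbase (sc u) := by rw [FTwo, if_neg hzno]
  obtain ⟨v, hv, n, hn⟩ := rep_cases_near hd1 huorb huim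
  obtain ⟨hc1, hc2⟩ := rep_dist_comparable hd1 hv
  have hvim : 1 / 2 < v.im := by
    have : u.im = v.im := by rw [← UpperHalfPlane.coe_im, hn]; simp
    rw [← this]; exact huim
  have hva : dataTwo.a < ((s2 : ℂ) * v).im := by
    rw [dataTwo_a, Complex.mul_im]; simp; nlinarith [s2_pos]
  -- `FTwo z = Fbase(√2 v)`
  have hF' : FTwo z = dataTwo.Fbase ((s2 : ℂ) * v) := by
    rw [hF, sc, hn, show (s2 : ℂ) * (v + n) = (s2 : ℂ) * v + n * dataTwo.per by rw [dataTwo_per]; ring]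
    exact dataTwo.Fbase_add_int_mul_per hva n
  have hzne : (z : ℂ) - c₂' ≠ 0 := by
    intro h
    have : z = cmLevelTwo := by apply UpperHalfPlane.ext; rw [sub_eq_zero] at h; rw [h, c₂']
    exact hz (this ▸ MulAction.mem_orbit_self _)
  have hzpos : 0 < ‖(z : ℂ) - c₂'‖ := norm_pos_iff.mpr hzne
  have hvpos : 0 < ‖v - c₂'‖ := by linarith
  -- apply the `Fbase` bound at `w = √2 v`
  have hw : (s2 : ℂ) * v - p₂ = (s2 : ℂ) * (v - c₂') := by rw [p₂]; ring
  have hwn : ‖(s2 : ℂ) * v - p₂‖ = s2 * ‖v - c₂'‖ := by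
    rw [hw, norm_mul, Complex.norm_real, Real.norm_eq_abs, abs_of_pos s2_pos]
  have hKv := hK ((s2 : ℂ) * v) (by rw [hwn]; nlinarith [s2_lt_two]) hva
  rw [hF', hwn] at *
  have hlog : |Real.log (s2 * ‖v - c₂'‖) - Real.log ‖(z : ℂ) - c₂'‖| ≤ 2 * Real.log 2 := by
    rw [Real.log_mul s2_pos.ne' hvpos.ne']
    have hs2 : 0 < Real.log s2 ∧ Real.log s2 < Real.log 2 :=
      ⟨Real.log_pos one_lt_s2, Real.log_lt_log s2_pos s2_lt_two⟩
    have hlog2 : |Real.log ‖v - c₂'‖ - Real.log ‖(z : ℂ) - c₂'‖| ≤ Real.log 2 := by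
      rw [← Real.log_div hvpos.ne' hzpos.ne', abs_le]
      constructor
      · rw [← Real.log_inv]
        apply Real.log_le_log (by positivity)
        rw [le_div_iff₀ hzpos]; linarith
      · apply Real.log_le_log (by positivity)
        rw [div_le_iff₀ hzpos]; linarith
    rw [abs_le] at hlog2 ⊢
    constructor <;> linarith [hlog2.1, hlog2.2]
  have e : dataTwo.Fbase ((s2 : ℂ) * v) + 2 * αTwo * Real.log ‖(z : ℂ) - c₂'‖ =
      (dataTwo.Fbase ((s2 : ℂ) * v) + 2 * αTwo * Real.log (s2 * ‖v - c₂'‖)) -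
        2 * αTwo * (Real.log (s2 * ‖v - c₂'‖) - Real.log ‖(z : ℂ) - c₂'‖) := by ring
  rw [e]
  have ha : 0 ≤ 2 * αTwo := by linarith [αTwo_pos]
  calc |dataTwo.Fbase ((s2 : ℂ) * v) + 2 * αTwo * Real.log (s2 * ‖v - c₂'‖) -
        2 * αTwo * (Real.log (s2 * ‖v - c₂'‖) - Real.log ‖(z : ℂ) - c₂'‖)|
      ≤ |dataTwo.Fbase ((s2 : ℂ) * v) + 2 * αTwo * Real.log (s2 * ‖v - c₂'‖)| +
        |2 * αTwo * (Real.log (s2 * ‖v - c₂'‖) - Real.log ‖(z : ℂ) - c₂'‖)| := abs_sub _ _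
    _ ≤ K + 2 * αTwo * (2 * Real.log 2) := by
        rw [abs_mul, abs_of_nonneg ha]
        gcongr

end NearCorner

/-! ## 9. Matching with `G₂^{Γ₀(2)}(·, c₂)` and the value at `i/√2` -/

section Matching

/-- The normalisation constant `C₂ := −#Stab(c₂)/α₂ = −128π²`. [folklore] -/
def CTwo : ℝ := -(4 : ℝ) / αTwo

/-- `C₂ = −128π²`. [folklore] -/
theorem CTwo_eq : CTwo = -(128 : ℝ) * π ^ 2 := by
  rw [CTwo, αTwo]
  have : (π : ℝ) ≠ 0 := Real.pi_ne_zero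
  field_simp; norm_num

variable (hreal : (dataTwo.M₁ Complex.I).im = 0)
include hreal

/-- **`G₂^{Γ₀(2)}(z, c₂) = C₂ · FTwo(z)` off the orbit of `c₂`** (uniqueness of the resolvent Green
function). [cite: GrossZagier1986, §II.2] -/
theorem higherGreen_eq_CTwo_mul_FTwo (z : ℍ) (hz : z ∉ MulAction.orbit (Gamma0 2) cmLevelTwo) :
    higherGreen 2 2 1 z cmLevelTwo = CTwo * FTwo z := by
  have h := higherGreen_eq_neg_card_div_mul two_pos (isResolventGreenLike_FTwo hreal) αTwo_pos.ne'
    (by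
      obtain ⟨C, ε, hε, hC⟩ := FTwo_log_bound
      exact ⟨C, ε, hε, fun w hw hd => hC w hw hd⟩) z hz
  rw [h, card_stabilizer_cmLevelTwo, CTwo]
  norm_num

omit hreal in
/-- Coordinates of `cmLevelTwo' = i/√2`. [folklore] -/
theorem coe_cmLevelTwo' : ((cmLevelTwo' : ℍ) : ℂ) = ⟨0, 1 / s2⟩ := rfl

omit hreal in
/-- `√2 · (i/√2) = i`. [folklore] -/
theorem sc_cmLevelTwo' : sc cmLevelTwo' = Complex.I := by
  rw [sc, coe_cmLevelTwo']
  have hs : s2 ≠ 0 := s2_pos.ne'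
  apply Complex.ext
  · simp
  · simp [Complex.mul_im]; field_simp

omit hreal in
/-- `i/√2 ∈ 𝒟₂` (on the arc) and off the corner orbit. [folklore] -/
theorem cmLevelTwo'_mem_fdTwo : cmLevelTwo' ∈ fdTwo ∧ cmLevelTwo' ∉ cornerOrb := by
  have hs : s2 ≠ 0 := s2_pos.ne'
  have him : cmLevelTwo'.im = 1 / s2 := by rw [← UpperHalfPlane.coe_im, coe_cmLevelTwo']
  have hgt : 1 / 2 < 1 / s2 := one_div_lt_one_div_of_lt s2_pos s2_lt_two
  refine ⟨⟨?_, ?_⟩, fun h => ?_⟩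
  · rw [← UpperHalfPlane.coe_re, coe_cmLevelTwo']; simp
  · rw [coe_cmLevelTwo', Complex.normSq_mk]
    have : (1 / s2) * (1 / s2) = 1 / 2 := by field_simp; linarith [s2_sq]
    nlinarith
  · have := im_le_half_of_mem_cornerOrb h
    rw [him] at this
    linarith

/-- `FTwo(i/√2) = Fbase(i)`. [folklore] -/
theorem FTwo_cmLevelTwo' : FTwo cmLevelTwo' = dataTwo.Fbase Complex.I := by
  obtain ⟨hfd, hno⟩ := cmLevelTwo'_mem_fdTwo
  rw [FTwo_eq_of_rep hreal hno (mem_orbTwo_self _) hfd, sc_cmLevelTwo']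

/-- At `z = i/√2`: `G₂^{Γ₀(2)}(i/√2, c₂) = C₂ · Fbase(i)`. [cite: Zhou2015, Remark 9] -/
theorem higherGreen_cmLevelTwo'_cmLevelTwo :
    higherGreen 2 2 1 cmLevelTwo' cmLevelTwo = CTwo * dataTwo.Fbase Complex.I := by
  have hno : cmLevelTwo' ∉ MulAction.orbit (Gamma0 2) cmLevelTwo := fun h =>
    cmLevelTwo'_mem_fdTwo.2 ((mem_orbit_iff_mem_cornerOrb _).mp h)
  rw [higherGreen_eq_CTwo_mul_FTwo hreal _ hno, FTwo_cmLevelTwo' hreal]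

end Matching

/-! ## 10. Assembly of Remark 9 (iii)a given the two real-axis inputs -/

section Final

/-- `g₂(it) = f₂(i t/√2)`. [folklore] -/
theorem gTwo_axisPt {t : ℝ} (ht : 0 < t) : gTwo (EllipticCurves.ModularForms.axisPt t) = fTwo (EllipticCurves.ModularForms.axisPt (t / s2)) := by
  rw [gTwo]; congr 1
  apply UpperHalfPlane.ext
  rw [coe_scaleDown, EllipticCurves.ModularForms.coe_axisPt ht, EllipticCurves.ModularForms.coe_axisPt (div_pos ht s2_pos)]
  push_cast; ring

variable {r : ℝ → ℝ} (hr : ∀ t : ℝ, 0 < t → fTwo (EllipticCurves.ModularForms.axisPt t) = (r t : ℂ))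
include hr

/-- `Im M₁(i) = 0` for the level-two datum when `f₂` is real on the imaginary axis. [folklore] -/
theorem M₁_I_im_eq_zero_two : (dataTwo.M₁ Complex.I).im = 0 :=
  dataTwo.M₁_I_im_eq_zero (r := fun t => r (t / s2)) fun t ht => by
    rw [dataTwo_g, gTwo_axisPt ht, hr _ (div_pos ht s2_pos)]

variable {L : ℝ} (hL : ∫ u in Ioi (1 / Real.sqrt 2), fTwo (EllipticCurves.ModularForms.axisPt u) = (((256 * π)⁻¹ * L : ℝ) : ℂ))
include hL

omit hr in
/-- `∫_{t>1} g₂(it) dt = √2 ∫_{u>1/√2} f₂(iu) du`. [folklore] -/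
theorem integral_gTwo_axis :
    ∫ t in Ioi (1 : ℝ), gTwo (EllipticCurves.ModularForms.axisPt t) = (s2 : ℂ) * (((256 * π)⁻¹ * L : ℝ) : ℂ) := by
  have h1 : ∫ t in Ioi (1 : ℝ), gTwo (EllipticCurves.ModularForms.axisPt t) = ∫ t in Ioi (1 : ℝ), (fun u => fTwo (EllipticCurves.ModularForms.axisPt u)) (s2⁻¹ * t) := by
    refine setIntegral_congr_fun measurableSet_Ioi fun t ht => ?_
    rw [gTwo_axisPt (zero_lt_one.trans ht)]
    simp [div_eq_inv_mul]
  rw [h1, integral_comp_mul_left_Ioi (fun u => fTwo (EllipticCurves.ModularForms.axisPt u)) 1 (inv_pos.mpr s2_pos), inv_inv, mul_one,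
    show s2⁻¹ = 1 / Real.sqrt 2 by rw [one_div]; rfl, hL, Complex.real_smul]

/-- **Remark 9 (iii)a from the two axis inputs**:
`G₂^{Γ₀(2)}(c₂, i/√2) = −(2π/√2)·L` where `L = 256π ∫_{u>1/√2} f₂(iu) du`. [cite: Zhou2015, Remark 9] -/
theorem higherGreen_cmLevelTwo_of_axis :
    higherGreen 2 2 1 cmLevelTwo cmLevelTwo' = -(2 * π / Real.sqrt 2) * L := by
  rw [higherGreen_symm one_pos, higherGreen_cmLevelTwo'_cmLevelTwo (M₁_I_im_eq_zero_two hr), dataTwo.Fbase_I,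
    dataTwo.M₀_I, dataTwo_g, integral_gTwo_axis hL, CTwo_eq]
  simp only [Complex.mul_im, Complex.I_re, Complex.I_im, Complex.ofReal_re, Complex.ofReal_im,
    Complex.mul_re, zero_mul, one_mul, zero_add, mul_zero, sub_zero, add_zero]
  have hπ : (π : ℝ) ≠ 0 := Real.pi_ne_zero
  have hs : Real.sqrt 2 ≠ 0 := s2_pos.ne'
  have h2 : s2 = Real.sqrt 2 := rfl
  rw [h2]
  field_simp
  have := s2_mul_s2
  rw [h2] at this
  linear_combination (-128 * L) * this

end Final

end Literature.NumberTheory.Automorphic.GreenTwo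

end
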